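import Summits.HodgeConjecture.HodgeConjecture.Theorems.F0P3cStCharTSDatumJunction4   -- ★ p851562 (LH6-p01) «DATUM-JUNCTION v4»: BODY ⟸ 59 hypotheses (brings the organ's vocabulary and every ★ slice it folds)
import Summits.HodgeConjecture.HodgeConjecture.Theorems.F0P3cStCharTSDatumWitness     -- ★ p851368 (LH6-p01) WITNESS: `exists_datum_with_fields`
import Summits.HodgeConjecture.HodgeConjecture.Theorems.F0P3cStCharTSCharField        -- ★ p851211 (LH6-p01) S1: `exists_charFamily_charRegularity_Gqs`
import Summits.HodgeConjecture.HodgeConjecture.Theorems.F0P3cStCharTSDGField          -- ★ p851395 (LH4-p02) DG-FIELD: formula pins `measurable_DG`, `DG_eq_zero_or_le`, `DG_coe_torus_eq_of_unit_rel`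
import Summits.HodgeConjecture.HodgeConjecture.Theorems.F0P3cStCharTSDGFieldTwo       -- ★ p851405 (F0P3-p02) DG-FIELD-TWO: `exists_DG_field_two`
import Summits.HodgeConjecture.HodgeConjecture.Theorems.F0P3cStCharTSStPin            -- ★ p851514 (F0P2-p06) ST-PIN: `exists_stDetFields`
import Summits.HodgeConjecture.HodgeConjecture.Theorems.F0P3cStCharTSXiSurj           -- ★ p851549 (LH6-p03) XI-SURJ ∕ KEYS-PAIRS: `exists_keysFields_Hv_pairs`
import Summits.HodgeConjecture.HodgeConjecture.Theorems.F0P3cStCharTSHFieldsHcb       -- ★ p851509 (F0P2-p01) H-FIELDS-HCB: `exists_charSt_packetCharHRegularity_hcb`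
import Summits.HodgeConjecture.HodgeConjecture.Theorems.F0P3cStCharTSParFieldW        -- ★ p851474 (LH6-p03) PAR-FIELD-W: `exists_parField_W`
import Summits.HodgeConjecture.HodgeConjecture.Theorems.F0P3cStCharTSHcbH             -- ★ p851449 (F0P3-p02) `hHBH_of_compactBound`, `hHBH_cartanH_of_compactBound`
import Summits.HodgeConjecture.HodgeConjecture.Theorems.F0P3cStCharTSOrbit            -- ★ p851442 (LH6-p03) ORBIT: `isConstituentOf_iff_of_common_constituent`
import Summits.HodgeConjecture.HodgeConjecture.Theorems.F0P3cStCharTSStJH             -- ★ p851573 (F0P2-p06) ST-JH: `stJH_datum`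
import Summits.HodgeConjecture.HodgeConjecture.Theorems.F0P3cStCharTSCartanNullDischarge  -- ★ p851428 (F0P3-p04): `isFiniteMeasure_of_compact_haar`, `rootKernels_of_compact_centralizers`
import Literature.NumberTheory.Rogawski1990.ShalikaGermHomogeneityNonsplit             -- ★ p851627 (LH4-p03) GERM-RESIDUE letter: `ShalikaGermResidueAtTorus` (+ `_iff`)
import Summits.HodgeConjecture.HodgeConjecture.Theorems.F0P3cStCharTSDHLc             -- ★ p851612 (F0P3-p02) DH-LC: `DG₂_eq_dgFormulaTwo` (the rank-2 closed formula from the two letters)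
import Summits.HodgeConjecture.HodgeConjecture.Theorems.F0P3cStCharTSHstabHolds       -- ★ p851812 (F0P3-p04) ST-STABLE-H: `hstab_holds` (the outer `hstab` of v1–v3 is a theorem)
import Literature.NumberTheory.Rogawski1990.SemilocalQuadraticCharExtension          -- ★ `isQuadraticCharExtension_semilocalComponent_of_baseChange_eq` (the outer `hμq` of v1–v3 is a theorem)
import Summits.HodgeConjecture.HodgeConjecture.Theorems.F0P3cStCharTSRung0Cartan       -- ★ (this seat) INSTANTIATE-CARTAN: `exists_cartanInputs`
import Summits.HodgeConjecture.HodgeConjecture.Theorems.F0P3cStCharTSLdsTwoOfTwo       -- ★ p852080 (LH6-p02 g7) LDS-TWO-OF-TWO: `ldsTwo_of_ldsReducibleTwo` (hLdsTwo ⟸ «two distinct constituents»)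
import HarnessLib

/-!
# F0 · P3c · line LH6 «StCharTS» — RUNG 0 v6 of the DATUM ROAD («WIF FOLD», LEAD T14-15): the (S-𝔇) organ IN ITS JUNCTION-v6 FORM (`∃ 𝔇 d T par μ_v, ‹the 58 hypotheses of ★ JUNCTION v6›`:
# ED. 21's text with `UpSpec` ↦ `UpTr`) FROM THE NAMED BLOCK over the CONSTRUCTED §12.5 datum — v3 (★ p851963, LH-ref1's four leak fixes) with `hstab` AND `hμq` FOLDED (★ HSTAB-HOLDS, ★ `isQuadraticCharExtension_semilocalComponent_of_baseChange_eq` — F0P3-p04's rider v3R) and `UpSpec` ↦ `UpTr`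

Cell `pub/hodgecm-mathlib`, crux H413 = `stmt-HodgeConjecture-24833` (lane `--supports …`), route HCCMUnconditional; seat LH6-p01 (g5) (datum-road map owner ∕ junction–rung-0 pen).
THEOREMS ONLY (no definition ∕ instance ∕ notation ∕ named fact ∕ `sorry`); ★-only imports.  v1 (★ p851651), v2 (★ p851915), v3 (★ p851963) are untouched.

WHAT.  `ellipticPackage_hyps_of_namedBlock₆` (v6 = v5 concluding the junction-v7 form: block consequent WIF GONE — ★ `weylIntegrationFormula_of_datumPins` inside ★ JUNCTION v7 — the new junction pins `hcovA hncA hcptA hinvT hcoreT` DISCHARGED here from the Cartan binders of `hBlock'` via ★ INSTANTIATE-CARTAN ED. 2, with NO new outer input (JAC-ELL C8's terminus ★ p852343 pays the compact-Cartan tube-Jacobian socket inside ★ JUNCTION v7) — the WEYL INTEGRATION FORMULA has LEFT the organ; v5 = v4 with the CARTAN DATA FOLDED: `Sell μTf SH μTHf` are no longer outer objects — ★ INSTANTIATE-CARTAN `exists_cartanInputs` builds them — and the named block now quantifies over them: `hBlock' : ∀ Sell μTf SH μTHf, ‹12 Cartan binders› → ∀ 𝔇 par, PINS → CONS`; outer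 objects 5 → 1 (the type-(3) torus `T`), outer Prop binders 20 → 8; and `hLdsTwo` RE-LETTERED to `hLdsRedTwo` = «the unitary `i_G(χ₁,χ₂)` with `χ₁|_{F×} = 1`, `χ₁ ≠ 1` has two DISTINCT constituents» [Keys1984 §7 Thm. (1); R90 §12.2 (3)] via ★ LDS-TWO-OF-TWO, an equivalence): under the organ's binder prefix (verbatim, up to `μZ`), GIVEN
* §1.6 `Ch1.characterLocallyIntegrable` and (HC-B) `normalizedCharacter_locallyBounded` (the leaf's two named analytic facts);
* the CARTAN DATA as parameters `Sell μTf SH μTHf T` with their print properties — `hcartO`∕`hcovGO`∕`hncGO`: `Sell` = compact centralisers `Z(γ₀)` of regular elements, `insert M Sell`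
  a complete irredundant system of Cartan representatives; `hHaarGO`∕`hcoreGO`∕`hHaarMO`∕`hcoreMO`: `μTf` Haar of mass one on the compact core, on each `T ∈ Sell` and on `M`;
  `hKHO`∕`hcovHO`∕`hncHO`∕`hHaarHO`∕`hprobHO`: `SH` compact `Z_H(γ₀)` (γ₀ `G`-regular), complete, irredundant, `μTHf` Haar probability [R90 §3.6, §12.5 pp. 182–184] (v1's `hfinGO`, `hkerO`, `hFHO` are now DERIVED:
  ★ CARTAN-NULL-DISCHARGE `isFiniteMeasure_of_compact_haar`∕`rootKernels_of_compact_centralizers`, and compact + Haar ⇒ finite on the `H` side);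
* (v4: `hstab` is GONE — ★ `F0P3cStCharTSHstabHolds.hstab_holds`, road ST-STABLE-H (B1)–(B4), F0P3-p04 ∕ F0P3a-p05 ∕ LH1-p03); `hT3` (type (3): no `L_w`-rational eigenvalue on `T^{reg}`);
  `hGerm` BY NAME = ★ `ShalikaGermResidueAtTorus L Φ₃ v mQv T` [§8.1 Prop. 8.1.1–8.1.2] (LH4-p03's Literature letter, p851627); (v4: `hμq` is GONE — ★ `isQuadraticCharExtension_semilocalComponent_of_baseChange_eq μ hμω v`);
* THREE MODEL-LEVEL NAMED FACTS new in JUNCTION v5: `hKeysRed` (Keys' list of reducible unitary principal series, ⇒-half [§12.2 p. 173; Keys1984 §7]), `hLdsTwo` (an l.d.s.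
  `i_G(χ)` has exactly two constituents [§12.2 (3) p. 174]), `hDGliO` ((HC-D) `|D_G|^{−1∕2} ∈ L¹_loc(G, νQv)` in CLOSED FORM on the organ's `νQv` [HarishChandra1970 VII §1 Thm. 15]);
* the NAMED BLOCK `hBlock`: for every `𝔇 par` whose fields satisfy the 50 PINS (the 41 field hypotheses of ★ JUNCTION v5 that are equations ∕ ★-pin transports at the datum —
  COMPAT ×7, `hE hchar hAll hHaar hcart hHaarG hfinG hker eDG eDH hKH hFH hHBH hNL hPSpar hLdsF hW hStH hRegH hUp hHBHP hlabels hSt hStJH hKeysJH hM1lc hIrr hKeys hDet hM1H hStL2` —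
  plus the nine EXTRA equalities `cartanG = Sell`, `μT = μTf`, `cartanH = SH`, `μTH = μTHf`, `regH`, `ellH`, `sqPacketsH = {{πSt}}`, `charH` constant, the ★ ST-PIN clause block)
  the TEN PRINTED STATEMENTS hold: WIF [§12.5 p. 182] · UpTr = «`α^G` is the distribution `f ↦ ∫ f^H α dh`» [p. 183, the display; v4: `UpSpec`'s other two clauses are in-house, ★ UP-MEAS∀ ∕ UP-CLASS] · Prop. 12.5.2 · [K] pseudo-coefficients · Prop. 12.6.1 (a)(b)(c) · «elliptic ⟸ not principal series»
  [§12.6 p. 187] · (M5) · (R0) — together with the formal degrees `∃ d, (PL) ∧ (d > 0)` [§12.6 p. 189]  (v1's consequents (UPR) (UNIQ-PAR) `hRedJH` `hDHst` `hK2` are ★ since v5);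
THEN the organ in its junction-v6 form: `∃ 𝔇 d T par μ_v, ‹58 hypotheses of ★ JUNCTION v6, in order, as a conjunction›` (from which ★ JUNCTION v6 gives the ED. 17 body).
PROOF = v1's: the ★ ∃-pins (S1 CHAR-FIELD, DG-FIELD, DG-FIELD-TWO's closed formula, ST-PIN, KEYS-PAIRS, H-FIELDS-HCB, PAR-FIELD-W) → ★ WITNESS → the 50 antecedents → the block →
the 58 conjuncts (`μ_v :=` the local component of `μ`; `hStJH` by ★ ST-JH `stJH_datum`; `hKeysJH` by ★ KEYS-PAIRS (f); `hM1lc` from `χ_{St_H} = Θ` locally constant).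
v3 = v2 + THE FOUR LEAK FIXES of LH-ref1's BOX LH6 #23-pre (modification test: every object a consequent reads is pinned by identity ∕ iff, or by a property that determines it):
(1) OUTER DATA now DETERMINED — `Sell`: compact `Z(γ₀)` (γ₀ regular) + COVERAGE of every regular class by `insert M Sell` + IRREDUNDANCY (★ CARTAN-ALL `exists_cartanAll_weylShape`'s
three clauses token for token, `Sell := C.erase M`); `μTf`: Haar AND `μTf T (compactCore T) = 1` on `Sell` and on `M` (THE normalisation of the canonical orbital measures `mQv`, ★
`OrbitalMeasureFamily.IsCanonical`; = the `htT` letter of ★ WIF-AT-THE-DATUM `weylIntegrationFormula_of_cartanFinset_of_tubeJacobians`); `SH`∕`μTHf`: the four clauses of ★ CARTAN-ELL-H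
`F0P3cStCharTSCartanFinTwo.cartanEllH` token for token (compact `Z_H(γ₀)` with γ₀ `G`-regular, Haar PROBABILITY, coverage, pairwise non-conjugacy) — so `SH := ∅`, `μTHf := 0`,
`μTf := 2 • μTf`, `Sell := ∅` are no longer admissible outer data; (2) `irredPS` pinned from BELOW too (`eIrr`, the ★ WITNESS's second `irredPS` clause) so (EllNotPS) reads THE set of
constituents of irreducible principal series; (3) `pi2`∕`piN` LABELLED BY ξ′ (`eLab` = clause 2 of ★ KEYS-PAIRS `exists_keysFields_Hv_pairs`: for ξ′ = (η₁∘det, η₂∘det·det) the pair IS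
the Keys pair of (η₁, η₂); with `hKeys` (L² flags) the ordered pair is determined) on top of v5's coverage `hKeysJH`; (4) `charH` locally constant at `G`-regular points (`hM1lc`, already
in v2) — with the a.e. trace identity of (M1H) this determines `χ_ρ` on the `G`-regular set.  RESIDUAL FREEDOM (declared): `par` up to `W` (C-invariant, ★ UNIQ-PAR ∕ ORBIT), `char` off
`regG` (never read), the conjugation-representative choice inside `Sell`∕`SH` (consequents are sums over representatives of class functions against transported Haar measures).
HONESTY: as v1 — every antecedent is an `Eq`∕`Iff`∕★-pin on a read field, the proof EXHIBITS a datum meeting all of them (non-vacuity certificate: ★ WITNESS `exists_datum_with_fields`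
+ this proof), so each consequent is the printed theorem about THOSE objects.  HONEST LABEL: HC_CM is proved only modulo the 7 printed citations (2 remaining named inputs:
hLiu418 = `stmt-HodgeConjecture-24832`, h413 = `stmt-HodgeConjecture-24833`) until rung 0 closes; this file closes no organ — it re-states (S-𝔇)'s remaining debt (count-neutral).

## References
* [Rogawski1990] J. D. Rogawski, *Automorphic Representations of Unitary Groups in Three Variables*, Ann. of Math. Stud. 123 (1990): §1.6 p. 5; §3.6 pp. 28–31; §8.1 pp. 112–116;
  §12.2 pp. 172–174; §12.5 pp. 182–187; §12.6 pp. 187–189; Lemma 12.7.2 (proof) pp. 191–194.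
* [Keys1984] D. Keys, *Principal series representations of special unitary groups over local fields*, Compositio Math. 51 (1984), §7.
* [HarishChandra1970] Harish-Chandra (notes by G. van Dijk), *Harmonic Analysis on Reductive p-adic Groups*, LNM 162 (1970): Part VII §1, Theorem 15.
-/

set_option autoImplicit false
-- the mandated namespace has the single-problem summit's repeated segment (`HodgeConjecture.HodgeConjecture`)
set_option linter.dupNamespace false

noncomputable section

open NumberField IsDedekindDomain MeasureTheory Filter Topology
open scoped Matrix MatrixGroups NNReal ENNReal
open Literature.MeasureTheory.Group
open Literature.NumberTheory.Rogawski1990 Literature.NumberTheory.Automorphic Literature.NumberTheory.Automorphic.UnitaryGroup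
open Literature.NumberTheory.Automorphic.UnitaryGroup.CotangentForms Literature.NumberTheory.GaloisRepresentations
open Literature.NumberTheory.Automorphic.Arthur2013.Leaves.TECR
open Summit.HodgeConjecture.HodgeConjecture.Cruxes.H413.F0P3cStCharTSTorusDefs

namespace Summit.HodgeConjecture.HodgeConjecture.Cruxes.H413.F0P3cStCharTSRung0Six

open scoped Classical in
set_option maxHeartbeats 8000000 in
set_option synthInstance.maxHeartbeats 400000 in
-- statement = the (S-𝔇) organ in its JUNCTION-v5 form behind the named block; proof = the ★ ∃-pins, the ★ witness, 50 pin transports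
/-- **RUNG 0 v6 — (S-𝔇) (JUNCTION-v7 form) from the NAMED BLOCK with the WEYL INTEGRATION FORMULA FOLDED (in house).**  See the module docstring for the census of hypotheses and the honesty argument.
[cite: Rogawski1990, §12.5 pp. 182–187; §12.6 pp. 187–189; Lemma 12.7.2 (proof) pp. 191–194; §1.6 p. 5; §3.6 pp. 28–31; §12.2 pp. 172–174; §8.1 pp. 112–116] [cite: Keys1984, §7] [cite: HarishChandra1970, Part VII §1 Thm. 15] -/

theorem ellipticPackage_hyps_of_namedBlock₆ :
  ∀ (L : Type) [Field L] [NumberField L] [IsCMField L] (μ : HeckeCharacter L) (ξ : OneDimAutRepH L) (v : HeightOneSpectrum (𝓞 ↥(maximalRealSubfield L))),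
    (∀ w : PlacesOver L v, IsCMField.complexConj L • w.1 = w.1) → μ.IsUnitary →
    (∀ x : Literature.NumberTheory.GaloisRepresentations.ideleGroup ↥(maximalRealSubfield L),
      μ (AdeleRing.ideleBaseChange (↥(maximalRealSubfield L)) L x) = quadraticHeckeCharCM L x) →
    ∀ [MeasurableSpace (((UnitaryGroup.cmDatum L 2 (Matrix.of fun i j : Fin 2 => if i.val + j.val + 1 = 2 then (1 : L) else 0)).Local v × (UnitaryGroup.cmDatum L 1 (Matrix.of fun i j : Fin 1 => if i.val + j.val + 1 = 1 then (1 : L) else 0)).Local v))] [BorelSpace (((UnitaryGroup.cmDatum L 2 (Matrix.of fun i j : Fin 2 => if i.val + j.val + 1 = 2 then (1 : L) else 0)).Local v × (UnitaryGroup.cmDatum L 1 (Matrix.of fun i j : Fin 1 => if i.val + j.val + 1 = 1 then (1 : L) else 0)).Local v))] [MeasurableSpace (Gqs L v)] [BorelSpace (Gqs L v)]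
      (νHv : Measure (((UnitaryGroup.cmDatum L 2 (Matrix.of fun i j : Fin 2 => if i.val + j.val + 1 = 2 then (1 : L) else 0)).Local v × (UnitaryGroup.cmDatum L 1 (Matrix.of fun i j : Fin 1 => if i.val + j.val + 1 = 1 then (1 : L) else 0)).Local v))) (νQv : Measure (Gqs L v))
      [νHv.IsHaarMeasure] [νHv.IsMulRightInvariant] [νQv.IsHaarMeasure] [νQv.IsMulRightInvariant],
    letI : ∀ a : ((UnitaryGroup.cmDatum L 2 (Matrix.of fun i j : Fin 2 => if i.val + j.val + 1 = 2 then (1 : L) else 0)).Local v × (UnitaryGroup.cmDatum L 1 (Matrix.of fun i j : Fin 1 => if i.val + j.val + 1 = 1 then (1 : L) else 0)).Local v), MeasurableSpace (((UnitaryGroup.cmDatum L 2 (Matrix.of fun i j : Fin 2 => if i.val + j.val + 1 = 2 then (1 : L) else 0)).Local v × (UnitaryGroup.cmDatum L 1 (Matrix.of fun i j : Fin 1 => if i.val + j.val + 1 = 1 then (1 : L) else 0)).Local v) ⧸ Subgroup.centralizer ({a} : Set (((UnitaryGroup.cmDatum L 2 (Matrix.of fun i j : Fin 2 => if i.val + j.val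 + 1 = 2 then (1 : L) else 0)).Local v × (UnitaryGroup.cmDatum L 1 (Matrix.of fun i j : Fin 1 => if i.val + j.val + 1 = 1 then (1 : L) else 0)).Local v)))) := fun _ => borel _
    haveI : ∀ a : ((UnitaryGroup.cmDatum L 2 (Matrix.of fun i j : Fin 2 => if i.val + j.val + 1 = 2 then (1 : L) else 0)).Local v × (UnitaryGroup.cmDatum L 1 (Matrix.of fun i j : Fin 1 => if i.val + j.val + 1 = 1 then (1 : L) else 0)).Local v), BorelSpace (((UnitaryGroup.cmDatum L 2 (Matrix.of fun i j : Fin 2 => if i.val + j.val + 1 = 2 then (1 : L) else 0)).Local v × (UnitaryGroup.cmDatum L 1 (Matrix.of fun i j : Fin 1 => if i.val + j.val + 1 = 1 then (1 : L) else 0)).Local v) ⧸ Subgroup.centralizer ({a} : Set (((UnitaryGroup.cmDatum L 2 (Matrix.of fun i j : Fin 2 => if i.val + j.val + 1 = 2 then (1 : L) else 0)).Local v × (UnitaryGroup.cmDatum L 1 (Matrix.of fun i j : Fin 1 => if i.val + j.val + 1 = 1 then (1 : L) else 0)).Local v)))) := fun _ => ⟨rfl⟩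
    letI : ∀ γ : Gqs L v, MeasurableSpace (Gqs L v ⧸ Subgroup.centralizer ({γ} : Set (Gqs L v))) := fun _ => borel _
    haveI : ∀ γ : Gqs L v, BorelSpace (Gqs L v ⧸ Subgroup.centralizer ({γ} : Set (Gqs L v))) := fun _ => ⟨rfl⟩
    ∀ (mHv : OrbitalMeasureFamily (((UnitaryGroup.cmDatum L 2 (Matrix.of fun i j : Fin 2 => if i.val + j.val + 1 = 2 then (1 : L) else 0)).Local v × (UnitaryGroup.cmDatum L 1 (Matrix.of fun i j : Fin 1 => if i.val + j.val + 1 = 1 then (1 : L) else 0)).Local v))) (mQv : OrbitalMeasureFamily (Gqs L v)),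
      mHv.IsCanonical (IsLocalGRegular L v) νHv →
      mQv.IsCanonical (fun γ => IsRegularElt (γ.val : GL (Fin 3) (UnitaryGroup.LocalRing L v))) νQv →
      IsLocalDeltaTransferExists L (qsForm L) v ((finExplicitCollection L (qsForm L) μ (finExplicitDelta_conj_left_all L (qsForm L) μ) (finExplicitDelta_conj_right_all L (qsForm L) μ)) v) mHv mQv IsLocSmooth IsLocSmooth →
      ∀ (π₁ πSt : IrrClass (((UnitaryGroup.cmDatum L 2 (Matrix.of fun i j : Fin 2 => if i.val + j.val + 1 = 2 then (1 : L) else 0)).Local v × (UnitaryGroup.cmDatum L 1 (Matrix.of fun i j : Fin 1 => if i.val + j.val + 1 = 1 then (1 : L) else 0)).Local v))),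
        HLengthTwoLabels L v
          (torusCharPair (conjLocal L (IsCMField.complexConj L) v) (cmLocalForm L 2 v) (cmLocalForm_eq_over L 2 v) 0
            ((torusLocalComponent L (IsCMField.complexConj L) v ξ.η).comp
                (quotConj (conjLocal L (IsCMField.complexConj L) v) (conjLocal_conjLocal_cm L v)) *
              halfModulusChar (UnitaryGroup.LocalRing L v))
            (torusLocalComponent L (IsCMField.complexConj L) v ξ.ψ))
          ((torusLocalComponent L (IsCMField.complexConj L) v ξ.ψ).comp (localDet (IsCMField.complexConj L) v (isUnit_antidiagOne_det L 1))) π₁ πSt →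
        (∀ fH : ((UnitaryGroup.cmDatum L 2 (Matrix.of fun i j : Fin 2 => if i.val + j.val + 1 = 2 then (1 : L) else 0)).Local v × (UnitaryGroup.cmDatum L 1 (Matrix.of fun i j : Fin 1 => if i.val + j.val + 1 = 1 then (1 : L) else 0)).Local v) → ℂ, IsLocSmooth fH → π₁.smoothTrace νHv fH = charDist (ξ.xiLocalChar v) νHv fH) →
      ∀ [MeasurableSpace (Gqs L v ⧸ Subgroup.center (Gqs L v))] [BorelSpace (Gqs L v ⧸ Subgroup.center (Gqs L v))]
        (μZ : Measure (Gqs L v ⧸ Subgroup.center (Gqs L v))) [μZ.IsHaarMeasure],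

      -- hHC
      Ch1.characterLocallyIntegrable →
      -- hHCB
      normalizedCharacter_locallyBounded →
      ∀ (T : Subgroup (Gqs L v)),
      -- hT3
      (∀ γ ∈ T, IsRegularElt (γ.val : GL (Fin 3) (UnitaryGroup.LocalRing L v)) → ∀ c : UnitaryGroup.LocalRing L v, ¬ ((γ.val.val : Matrix (Fin 3) (Fin 3) (UnitaryGroup.LocalRing L v)).charpoly).IsRoot c) →
      -- hGerm
      ShalikaGermResidueAtTorus L (qsForm L) v mQv T →
      -- hKeysRed
      (∀ (χ₁ : (UnitaryGroup.LocalRing L v)ˣ →* ℂˣ) (χ₂ : ↥(normOneUnits (conjLocal L (IsCMField.complexConj L) v)) →* ℂˣ), Continuous (fun x => ((χ₁ x : ℂˣ) : ℂ)) → Continuous (fun x => ((χ₂ x : ℂˣ) : ℂ)) → (∃ N : Subrepresentation (UnitaryGroup.cmPrincipalSeries L 3 v (UnitaryGroup.cmTorusCharPair L v χ₁ χ₂)), N ≠ ⊥ ∧ N ≠ ⊤) → (χ₁ = halfModulusChar (UnitaryGroup.LocalRing L v) * halfModulusChar (UnitaryGroup.LocalRing L v) ∨ χ₁ = (halfModulusChar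 (UnitaryGroup.LocalRing L v) * halfModulusChar (UnitaryGroup.LocalRing L v))⁻¹) ∨ (∃ η : (UnitaryGroup.LocalRing L v)ˣ →* ℂˣ, IsQuadraticCharExtension (conjLocal L (IsCMField.complexConj L) v) η ∧ Continuous (fun x => ((η x : ℂˣ) : ℂ)) ∧ (χ₁ = η * halfModulusChar (UnitaryGroup.LocalRing L v) ∨ χ₁ = η * (halfModulusChar (UnitaryGroup.LocalRing L v))⁻¹)) ∨ (χ₁ ≠ 1 ∧ ∀ a : (UnitaryGroup.LocalRing L v)ˣ, (conjLocal L (IsCMField.complexConj L) v) (a : UnitaryGroup.LocalRing L v) = a → χ₁ a = 1)) →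
      -- hLdsRedTwo
      (∀ (χ₁ : (UnitaryGroup.LocalRing L v)ˣ →* ℂˣ) (χ₂ : ↥(normOneUnits (conjLocal L (IsCMField.complexConj L) v)) →* ℂˣ), Continuous (fun x => ((χ₁ x : ℂˣ) : ℂ)) → Continuous (fun x => ((χ₂ x : ℂˣ) : ℂ)) → (∀ a : (UnitaryGroup.LocalRing L v)ˣ, (conjLocal L (IsCMField.complexConj L) v) (a : UnitaryGroup.LocalRing L v) = a → χ₁ a = 1) → χ₁ ≠ 1 → ∃ c₁ c₂ : IrrClass (Gqs L v), c₁ ≠ c₂ ∧ c₁.IsConstituentOf (UnitaryGroup.cmPrincipalSeries L 3 v (UnitaryGroup.cmTorusCharPair L v χ₁ χ₂)) ∧ c₂.IsConstituentOf (UnitaryGroup.cmPrincipalSeries L 3 v (UnitaryGroup.cmTorusCharPair L v χ₁ χ₂))) →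
      -- hDGliO
      LocallyIntegrable (fun g : (Gqs L v) => (((NNReal.sqrt (NNReal.sqrt ((∏ w : PlacesOver L v, IsNonarchimedeanLocalField.normAbs (w.1.adicCompletion L) (((g.val : GL (Fin 3) (UnitaryGroup.LocalRing L v)).val.charpoly.discr) w)) * ((∏ w : PlacesOver L v, IsNonarchimedeanLocalField.normAbs (w.1.adicCompletion L) (((g.val : GL (Fin 3) (UnitaryGroup.LocalRing L v)).val.det) w)) ^ 2)⁻¹)) : ℝ≥0) : ℝ))⁻¹) νQv →
      -- hBlock
      (∀ (Sell : Finset (Subgroup (Gqs L v))) (μTf : (T' : Subgroup (Gqs L v)) → Measure ↥T') (SH : Finset (Subgroup ((UnitaryGroup.cmDatum L 2 (Matrix.of fun i j : Fin 2 => if i.val + j.val + 1 = 2 then (1 : L) else 0)).Local v × (UnitaryGroup.cmDatum L 1 (Matrix.of fun i j : Fin 1 => if i.val + j.val + 1 = 1 then (1 : L) else 0)).Local v))) (μTHf : (T' : Subgroup ((UnitaryGroup.cmDatum L 2 (Matrix.of fun i j : Fin 2 => if i.val + j.val + 1 = 2 then (1 : L) else 0)).Local v × (UnitaryGroup.cmDatum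 L 1 (Matrix.of fun i j : Fin 1 => if i.val + j.val + 1 = 1 then (1 : L) else 0)).Local v)) → Measure ↥T'),
        (∀ T ∈ Sell, IsCompact (T : Set (Gqs L v)) ∧ ∃ γ₀ : Gqs L v, IsRegularElt (γ₀.val : GL (Fin 3) (UnitaryGroup.LocalRing L v)) ∧ T = Subgroup.centralizer ({γ₀} : Set (Gqs L v))) →  -- hcartO
        (∀ γ : (Gqs L v), IsRegularElt (γ.val : GL (Fin 3) (UnitaryGroup.LocalRing L v)) → ∃ T' ∈ insert (cmBorelTriple L 3 v).M Sell, ∃ x : (Gqs L v), ∀ g : (Gqs L v), g ∈ Subgroup.centralizer ({γ} : Set (Gqs L v)) ↔ x⁻¹ * g * x ∈ T') →  -- hcovGO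
        (∀ T' ∈ insert (cmBorelTriple L 3 v).M Sell, ∀ T'' ∈ insert (cmBorelTriple L 3 v).M Sell, T' ≠ T'' → ∀ y : (Gqs L v), ¬ ∀ h : (Gqs L v), h ∈ T'' ↔ y⁻¹ * h * y ∈ T') →  -- hncGO
        (∀ T ∈ Sell, (μTf T).IsHaarMeasure) →  -- hHaarGO
        (∀ T' ∈ Sell, μTf T' (compactCore ↥T') = 1) →  -- hcoreGO
        (μTf (cmBorelTriple L 3 v).M).IsHaarMeasure →  -- hHaarMO
        (μTf (cmBorelTriple L 3 v).M (compactCore ↥(cmBorelTriple L 3 v).M) = 1) →  -- hcoreMO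
        (∀ T' ∈ SH, IsCompact (T' : Set ((UnitaryGroup.cmDatum L 2 (Matrix.of fun i j : Fin 2 => if i.val + j.val + 1 = 2 then (1 : L) else 0)).Local v × (UnitaryGroup.cmDatum L 1 (Matrix.of fun i j : Fin 1 => if i.val + j.val + 1 = 1 then (1 : L) else 0)).Local v)) ∧ ∃ γ₀ : ((UnitaryGroup.cmDatum L 2 (Matrix.of fun i j : Fin 2 => if i.val + j.val + 1 = 2 then (1 : L) else 0)).Local v × (UnitaryGroup.cmDatum L 1 (Matrix.of fun i j : Fin 1 => if i.val + j.val + 1 = 1 then (1 : L) else 0)).Local v), IsLocalGRegular L v γ₀ ∧ T' = Subgroup.centralizer ({γ₀} : Set ((UnitaryGroup.cmDatum L 2 (Matrix.of fun i j : Fin 2 => if i.val + j.val + 1 = 2 then (1 : L) else 0)).Local v × (UnitaryGroup.cmDatum L 1 (Matrix.of fun i j : Fin 1 => if i.val + j.val + 1 = 1 then (1 : L) else 0)).Local v))) →  -- hKHO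
        (∀ γ₀ : ((UnitaryGroup.cmDatum L 2 (Matrix.of fun i j : Fin 2 => if i.val + j.val + 1 = 2 then (1 : L) else 0)).Local v × (UnitaryGroup.cmDatum L 1 (Matrix.of fun i j : Fin 1 => if i.val + j.val + 1 = 1 then (1 : L) else 0)).Local v), IsLocalGRegular L v γ₀ → IsCompact ((Subgroup.centralizer ({γ₀} : Set ((UnitaryGroup.cmDatum L 2 (Matrix.of fun i j : Fin 2 => if i.val + j.val + 1 = 2 then (1 : L) else 0)).Local v × (UnitaryGroup.cmDatum L 1 (Matrix.of fun i j : Fin 1 => if i.val + j.val + 1 = 1 then (1 : L) else 0)).Local v)) : Subgroup ((UnitaryGroup.cmDatum L 2 (Matrix.of fun i j : Fin 2 => if i.val + j.val + 1 = 2 then (1 : L) else 0)).Local v × (UnitaryGroup.cmDatum L 1 (Matrix.of fun i j : Fin 1 => if i.val + j.val + 1 = 1 then (1 : L) else 0)).Local v)) : Set ((UnitaryGroup.cmDatum L 2 (Matrix.of fun i j : Fin 2 => if i.val + j.val + 1 = 2 then (1 : L) else 0)).Local v × (UnitaryGroup.cmDatum L 1 (Matrix.of fun i j : Fin 1 =>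 if i.val + j.val + 1 = 1 then (1 : L) else 0)).Local v)) → ∃ T' ∈ SH, ∃ x : ((UnitaryGroup.cmDatum L 2 (Matrix.of fun i j : Fin 2 => if i.val + j.val + 1 = 2 then (1 : L) else 0)).Local v × (UnitaryGroup.cmDatum L 1 (Matrix.of fun i j : Fin 1 => if i.val + j.val + 1 = 1 then (1 : L) else 0)).Local v), Subgroup.centralizer ({x * γ₀ * x⁻¹} : Set ((UnitaryGroup.cmDatum L 2 (Matrix.of fun i j : Fin 2 => if i.val + j.val + 1 = 2 then (1 : L) else 0)).Local v × (UnitaryGroup.cmDatum L 1 (Matrix.of fun i j : Fin 1 => if i.val + j.val + 1 = 1 then (1 : L) else 0)).Local v)) = T') →  -- hcovHO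
        (∀ T' ∈ SH, ∀ T'' ∈ SH, (∃ x : ((UnitaryGroup.cmDatum L 2 (Matrix.of fun i j : Fin 2 => if i.val + j.val + 1 = 2 then (1 : L) else 0)).Local v × (UnitaryGroup.cmDatum L 1 (Matrix.of fun i j : Fin 1 => if i.val + j.val + 1 = 1 then (1 : L) else 0)).Local v), T'.map (MulAut.conj x).toMonoidHom = T'') → T' = T'') →  -- hncHO
        (∀ T' ∈ SH, (μTHf T').IsHaarMeasure) →  -- hHaarHO
        (∀ T' ∈ SH, IsProbabilityMeasure (μTHf T')) →  -- hprobHO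
        ∀ (𝔇 : Ch12Sec5.EllipticData (Gqs L v) ((UnitaryGroup.cmDatum L 2 (Matrix.of fun i j : Fin 2 => if i.val + j.val + 1 = 2 then (1 : L) else 0)).Local v × (UnitaryGroup.cmDatum L 1 (Matrix.of fun i j : Fin 1 => if i.val + j.val + 1 = 1 then (1 : L) else 0)).Local v)) (par : (IrrClass (Gqs L v) → ((((UnitaryGroup.LocalRing L v)ˣ →* ℂˣ) × (↥(normOneUnits (conjLocal L (IsCMField.complexConj L) v)) →* ℂˣ))))),
          𝔇.μG = νQv →  -- hC01
          𝔇.μH = νHv →  -- hC02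
          𝔇.μGZ = μZ →  -- hC03
          𝔇.orb = mQv →  -- hC04
          (∀ γ : Gqs L v, γ ∈ 𝔇.regG ↔ IsRegularElt (γ.val : GL (Fin 3) (UnitaryGroup.LocalRing L v))) →  -- hC05
          (∀ (φ : Gqs L v → ℂ) (fH : ((UnitaryGroup.cmDatum L 2 (Matrix.of fun i j : Fin 2 => if i.val + j.val + 1 = 2 then (1 : L) else 0)).Local v × (UnitaryGroup.cmDatum L 1 (Matrix.of fun i j : Fin 1 => if i.val + j.val + 1 = 1 then (1 : L) else 0)).Local v) → ℂ), 𝔇.IsTransfer φ fH ↔ IsLocalDeltaTransfer L (qsForm L) v ((finExplicitCollection L (qsForm L) μ (finExplicitDelta_conj_left_all L (qsForm L) μ) (finExplicitDelta_conj_right_all L (qsForm L) μ)) v) mHv mQv fH φ) →  -- hC06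
          ({πSt} : Finset (IrrClass (((UnitaryGroup.cmDatum L 2 (Matrix.of fun i j : Fin 2 => if i.val + j.val + 1 = 2 then (1 : L) else 0)).Local v × (UnitaryGroup.cmDatum L 1 (Matrix.of fun i j : Fin 1 => if i.val + j.val + 1 = 1 then (1 : L) else 0)).Local v)))) ∈ 𝔇.sqPacketsH →  -- hC07
          (∀ γ : Gqs L v, γ ∈ 𝔇.ellG ↔ IsRegularElt (γ.val : GL (Fin 3) (UnitaryGroup.LocalRing L v)) ∧ γ ∉ hyperbolicSet L v) →  -- hE
          (∀ π : IrrClass (Gqs L v), Measurable (𝔇.char π) ∧ LocallyIntegrable (𝔇.char π) 𝔇.μG ∧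
          (∀ x ∈ 𝔇.regG, ∀ᶠ y in 𝓝 x, 𝔇.char π y = 𝔇.char π x) ∧
          ∀ φ : Gqs L v → ℂ, IsLocSmooth φ → π.smoothTrace 𝔇.μG φ = ∫ x, φ x * 𝔇.char π x ∂𝔇.μG) →  -- hchar
          (∀ T : Subgroup (Gqs L v), T ∈ 𝔇.cartanAll ↔ T = (cmBorelTriple L 3 v).M ∨ T ∈ 𝔇.cartanG) →  -- hAll
          (𝔇.μT (cmBorelTriple L 3 v).M).IsHaarMeasure →  -- hHaar
          (∀ T ∈ 𝔇.cartanG, IsCompact (T : Set (Gqs L v)) ∧ ∃ γ₀ : Gqs L v, IsRegularElt (γ₀.val : GL (Fin 3) (UnitaryGroup.LocalRing L v)) ∧ T = Subgroup.centralizer ({γ₀} : Set (Gqs L v))) →  -- hcart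
          (∀ T ∈ 𝔇.cartanG, (𝔇.μT T).IsHaarMeasure) →  -- hHaarG
          (∀ T ∈ 𝔇.cartanG, IsFiniteMeasure (𝔇.μT T)) →  -- hfinG
          (∀ T ∈ 𝔇.cartanG, ∃ s : Finset (Subgroup ↥T), (∀ K ∈ s, IsClosed (K : Set ↥T) ∧ ¬ IsOpen (K : Set ↥T)) ∧ ∀ t : ↥T, ¬ IsRegularElt ((t : Gqs L v).val : GL (Fin 3) (UnitaryGroup.LocalRing L v)) → ∃ K ∈ s, t ∈ K) →  -- hker
          (∀ g : Gqs L v, 𝔇.DG g = ((NNReal.sqrt (NNReal.sqrt ((∏ w : PlacesOver L v, IsNonarchimedeanLocalField.normAbs (w.1.adicCompletion L) (((g.val : GL (Fin 3) (UnitaryGroup.LocalRing L v)).val.charpoly.discr) w)) * ((∏ w : PlacesOver L v, IsNonarchimedeanLocalField.normAbs (w.1.adicCompletion L) (((g.val : GL (Fin 3) (UnitaryGroup.LocalRing L v)).val.det) w)) ^ 2)⁻¹)) : ℝ≥0) : ℝ)) →  -- eDG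
          (∀ s : ((UnitaryGroup.cmDatum L 2 (Matrix.of fun i j : Fin 2 => if i.val + j.val + 1 = 2 then (1 : L) else 0)).Local v × (UnitaryGroup.cmDatum L 1 (Matrix.of fun i j : Fin 1 => if i.val + j.val + 1 = 1 then (1 : L) else 0)).Local v), 𝔇.DH s = ((NNReal.sqrt (NNReal.sqrt ((∏ w : PlacesOver L v, IsNonarchimedeanLocalField.normAbs (w.1.adicCompletion L) (((s.1.val : GL (Fin 2) (UnitaryGroup.LocalRing L v)).val.charpoly.discr) w)) * (∏ w : PlacesOver L v, IsNonarchimedeanLocalField.normAbs (w.1.adicCompletion L) (((s.1.val : GL (Fin 2) (UnitaryGroup.LocalRing L v)).val.det) w))⁻¹)) : ℝ≥0) : ℝ)) →  -- eDH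
          (∀ T ∈ 𝔇.cartanH, IsCompact (T : Set ((UnitaryGroup.cmDatum L 2 (Matrix.of fun i j : Fin 2 => if i.val + j.val + 1 = 2 then (1 : L) else 0)).Local v × (UnitaryGroup.cmDatum L 1 (Matrix.of fun i j : Fin 1 => if i.val + j.val + 1 = 1 then (1 : L) else 0)).Local v))) →  -- hKH
          (∀ T ∈ 𝔇.cartanH, IsFiniteMeasure (𝔇.μTH T)) →  -- hFH
          (∀ ρ ∈ 𝔇.sqPacketsH, ∀ T ∈ 𝔇.cartanH, ∀ C : Set ((UnitaryGroup.cmDatum L 2 (Matrix.of fun i j : Fin 2 => if i.val + j.val + 1 = 2 then (1 : L) else 0)).Local v × (UnitaryGroup.cmDatum L 1 (Matrix.of fun i j : Fin 1 => if i.val + j.val + 1 = 1 then (1 : L) else 0)).Local v), IsCompact C → C ⊆ (T : Set ((UnitaryGroup.cmDatum L 2 (Matrix.of fun i j : Fin 2 => if i.val + j.val + 1 = 2 then (1 : L) else 0)).Local v × (UnitaryGroup.cmDatum L 1 (Matrix.of fun i j : Fin 1 => if i.val + j.val + 1 = 1 then (1 : L) else 0)).Local v)) → ∃ B : ℝ,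 ∀ γ ∈ C, ‖(𝔇.DH γ : ℂ) * 𝔇.packetCharH ρ γ‖ ≤ B) →  -- hHBH
          (∀ π : IrrClass (Gqs L v), ¬ π.IsSquareIntegrable μZ → π.IsConstituentOf (UnitaryGroup.cmPrincipalSeries L 3 v (UnitaryGroup.cmTorusCharPair L v (par π).1 (par π).2)) ∧ Continuous (par π).1 ∧ Continuous (par π).2) →  -- hNL
          (∀ π : IrrClass (Gqs L v), (∃ (χ₁ : (UnitaryGroup.LocalRing L v)ˣ →* ℂˣ) (χ₂ : ↥(normOneUnits (conjLocal L (IsCMField.complexConj L) v)) →* ℂˣ), Continuous (fun x => ((χ₁ x : ℂˣ) : ℂ)) ∧ Continuous (fun x => ((χ₂ x : ℂˣ) : ℂ)) ∧ (UnitaryGroup.cmPrincipalSeries L 3 v (UnitaryGroup.cmTorusCharPair L v χ₁ χ₂)).IsIrreducible ∧ π.IsConstituentOf (UnitaryGroup.cmPrincipalSeries L 3 v (UnitaryGroup.cmTorusCharPair L v χ₁ χ₂))) → (UnitaryGroup.cmPrincipalSeries L 3 v (UnitaryGroup.cmTorusCharPair L v (par π).1 (par π).2)).IsIrreducible ∧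 π.IsConstituentOf (UnitaryGroup.cmPrincipalSeries L 3 v (UnitaryGroup.cmTorusCharPair L v (par π).1 (par π).2)) ∧ Continuous (par π).1 ∧ Continuous (par π).2 ∧ Continuous (fun x => (((par π).1 x : ℂˣ) : ℂ)) ∧ Continuous (fun x => (((par π).2 x : ℂˣ) : ℂ)) ∧ ∀ (ν : Measure (Gqs L v)) (f : Gqs L v → ℂ), π.smoothTrace ν f = Representation.smoothTrace (G := Gqs L v) (UnitaryGroup.cmPrincipalSeries L 3 v (UnitaryGroup.cmTorusCharPair L v (par π).1 (par π).2)) ν f) →  -- hPSpar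
          (∀ P : Finset (IrrClass (Gqs L v)), P ∈ 𝔇.ldsPackets ↔ (P.card = 2 ∧ ∃ (χ₁ : (UnitaryGroup.LocalRing L v)ˣ →* ℂˣ) (χ₂ : ↥(normOneUnits (conjLocal L (IsCMField.complexConj L) v)) →* ℂˣ), Continuous (fun x => ((χ₁ x : ℂˣ) : ℂ)) ∧ Continuous (fun x => ((χ₂ x : ℂˣ) : ℂ)) ∧ (∀ a : (UnitaryGroup.LocalRing L v)ˣ, (conjLocal L (IsCMField.complexConj L) v) (a : UnitaryGroup.LocalRing L v) = a → χ₁ a = 1) ∧ χ₁ ≠ 1 ∧ ∀ c : IrrClass (Gqs L v), c ∈ P ↔ c.IsConstituentOf (UnitaryGroup.cmPrincipalSeries L 3 v (UnitaryGroup.cmTorusCharPair L v χ₁ χ₂)))) →  -- hLdsF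
          (∀ (χ₁ : (UnitaryGroup.LocalRing L v)ˣ →* ℂˣ) (χ₂ : ↥(normOneUnits (conjLocal L (IsCMField.complexConj L) v)) →* ℂˣ), Continuous (fun x => ((χ₁ x : ℂˣ) : ℂ)) → Continuous (fun x => ((χ₂ x : ℂˣ) : ℂ)) → ∀ π π' : IrrClass (Gqs L v), ¬ π.IsSquareIntegrable μZ → ¬ π'.IsSquareIntegrable μZ → π.IsConstituentOf (UnitaryGroup.cmPrincipalSeries L 3 v (UnitaryGroup.cmTorusCharPair L v χ₁ χ₂)) → π'.IsConstituentOf (UnitaryGroup.cmPrincipalSeries L 3 v (UnitaryGroup.cmTorusCharPair L v χ₁ χ₂)) → par π = par π') →  -- hW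
          (∀ a b : ((UnitaryGroup.cmDatum L 2 (Matrix.of fun i j : Fin 2 => if i.val + j.val + 1 = 2 then (1 : L) else 0)).Local v × (UnitaryGroup.cmDatum L 1 (Matrix.of fun i j : Fin 1 => if i.val + j.val + 1 = 1 then (1 : L) else 0)).Local v), 𝔇.stConjH a b ↔ IsLocalStablyConjH L v a b) →  -- hStH
          (∀ a : ((UnitaryGroup.cmDatum L 2 (Matrix.of fun i j : Fin 2 => if i.val + j.val + 1 = 2 then (1 : L) else 0)).Local v × (UnitaryGroup.cmDatum L 1 (Matrix.of fun i j : Fin 1 => if i.val + j.val + 1 = 1 then (1 : L) else 0)).Local v), IsLocalGRegular L v a → a ∈ 𝔇.regH) →  -- hRegH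
          (∀ (α : ((UnitaryGroup.cmDatum L 2 (Matrix.of fun i j : Fin 2 => if i.val + j.val + 1 = 2 then (1 : L) else 0)).Local v × (UnitaryGroup.cmDatum L 1 (Matrix.of fun i j : Fin 1 => if i.val + j.val + 1 = 1 then (1 : L) else 0)).Local v) → ℂ) (x : Gqs L v), 𝔇.up α x = if IsRegularElt (x.val : GL (Fin 3) (UnitaryGroup.LocalRing L v)) then ((𝔇.DG x : ℂ))⁻¹ * ∑ᶠ q : Quot (IsLocalStablyConjH L v), (if IsLocalGRegular L v q.out ∧ IsLocalNormPair L (qsForm L) v q.out x then finTau L v q.out μ * (𝔇.DH q.out : ℂ) * ((finKappaAt L v (qsForm L) q.out x : ℤ) : ℂ) * α q.out else 0) else 0) →  -- hUp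
          (∀ ρ ∈ 𝔇.sqPacketsH, ∀ C : Set ((UnitaryGroup.cmDatum L 2 (Matrix.of fun i j : Fin 2 => if i.val + j.val + 1 = 2 then (1 : L) else 0)).Local v × (UnitaryGroup.cmDatum L 1 (Matrix.of fun i j : Fin 1 => if i.val + j.val + 1 = 1 then (1 : L) else 0)).Local v), IsCompact C → ∃ B : ℝ, ∀ s ∈ C, IsLocalGRegular L v s → ‖(𝔇.DH s : ℂ) * 𝔇.packetCharH ρ s‖ ≤ B) →  -- hHBHP
          (∀ ξ' : ((UnitaryGroup.cmDatum L 2 (Matrix.of fun i j : Fin 2 => if i.val + j.val + 1 = 2 then (1 : L) else 0)).Local v × (UnitaryGroup.cmDatum L 1 (Matrix.of fun i j : Fin 1 => if i.val + j.val + 1 = 1 then (1 : L) else 0)).Local v) →* ℂˣ, Continuous ξ' → ∃ (η₁ η₂ : ↥(normOneUnits (conjLocal L (IsCMField.complexConj L) v)) →* ℂˣ), Continuous (fun x => ((η₁ x : ℂˣ) : ℂ)) ∧ Continuous (fun x => ((η₂ x : ℂˣ) : ℂ)) ∧ KeysCaseTwoLabels L v (μ.semilocalComponent L v) η₁ η₂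 (𝔇.pi2 ξ') (𝔇.piN ξ')) →  -- hlabels
          (∀ ψ' : ↥(Subgroup.center (Gqs L v)) →* ℂˣ, Continuous ψ' → ∃ ψ : ↥(normOneUnits (conjLocal L (IsCMField.complexConj L) v)) →* ℂˣ, Continuous ψ ∧ 𝔇.stG ψ' ≠ 𝔇.detG ψ' ∧ ∀ c : IrrClass (Gqs L v), c.IsConstituentOf (UnitaryGroup.cmPrincipalSeries L 3 v (UnitaryGroup.cmTorusCharPair L v (halfModulusChar (UnitaryGroup.LocalRing L v) * halfModulusChar (UnitaryGroup.LocalRing L v))⁻¹ ψ)) ↔ (c = 𝔇.stG ψ' ∨ c = 𝔇.detG ψ')) →  -- hSt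
          (∀ ψ₀ : ↥(normOneUnits (conjLocal L (IsCMField.complexConj L) v)) →* ℂˣ, Continuous (fun x => ((ψ₀ x : ℂˣ) : ℂ)) → ∃ ψ : ↥(Subgroup.center (Gqs L v)) →* ℂˣ, Continuous ψ ∧ ∀ c : IrrClass (Gqs L v), c.IsConstituentOf (UnitaryGroup.cmPrincipalSeries L 3 v (UnitaryGroup.cmTorusCharPair L v (halfModulusChar (UnitaryGroup.LocalRing L v) * halfModulusChar (UnitaryGroup.LocalRing L v))⁻¹ ψ₀)) ↔ (c = 𝔇.stG ψ ∨ c = 𝔇.detG ψ)) →  -- hStJH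
          (∀ (η₁ η₂ : ↥(normOneUnits (conjLocal L (IsCMField.complexConj L) v)) →* ℂˣ), Continuous (fun x => ((η₁ x : ℂˣ) : ℂ)) → Continuous (fun x => ((η₂ x : ℂˣ) : ℂ)) → ∃ ξ' : ((UnitaryGroup.cmDatum L 2 (Matrix.of fun i j : Fin 2 => if i.val + j.val + 1 = 2 then (1 : L) else 0)).Local v × (UnitaryGroup.cmDatum L 1 (Matrix.of fun i j : Fin 1 => if i.val + j.val + 1 = 1 then (1 : L) else 0)).Local v) →* ℂˣ, Continuous ξ' ∧ KeysCaseTwoLabels L v (μ.semilocalComponent L v) η₁ η₂ (𝔇.pi2 ξ') (𝔇.piN ξ')) →  -- hKeysJH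
          (∀ ρ ∈ 𝔇.sqPacketsH, ∀ a : ((UnitaryGroup.cmDatum L 2 (Matrix.of fun i j : Fin 2 => if i.val + j.val + 1 = 2 then (1 : L) else 0)).Local v × (UnitaryGroup.cmDatum L 1 (Matrix.of fun i j : Fin 1 => if i.val + j.val + 1 = 1 then (1 : L) else 0)).Local v), IsLocalGRegular L v a → ∀ᶠ a' in 𝓝 a, 𝔇.packetCharH ρ a' = 𝔇.packetCharH ρ a) →  -- hM1lc
          (∀ γ : Gqs L v, IsRegularElt (γ.val : GL (Fin 3) (UnitaryGroup.LocalRing L v)) → ∃ T' ∈ 𝔇.cartanAll, ∃ x : Gqs L v, ∀ g : Gqs L v, g ∈ Subgroup.centralizer ({γ} : Set (Gqs L v)) ↔ x⁻¹ * g * x ∈ T') →  -- hcovA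
          (∀ T' ∈ 𝔇.cartanAll, ∀ T'' ∈ 𝔇.cartanAll, T' ≠ T'' → ∀ y : Gqs L v, ¬ ∀ h : Gqs L v, h ∈ T'' ↔ y⁻¹ * h * y ∈ T') →  -- hncA
          (∀ T' ∈ 𝔇.cartanAll, T' ≠ (cmBorelTriple L 3 v).M → IsCompact (T' : Set (Gqs L v))) →  -- hcptA
          (∀ T' ∈ 𝔇.cartanAll, (𝔇.μT T').IsInvInvariant) →  -- hinvT
          (∀ T' ∈ 𝔇.cartanAll, 𝔇.μT T' (compactCore ↥T') = 1) →  -- hcoreT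
          (∀ π ∈ 𝔇.irredPS, ∃ (χ₁ : (UnitaryGroup.LocalRing L v)ˣ →* ℂˣ) (χ₂ : ↥(normOneUnits (conjLocal L (IsCMField.complexConj L) v)) →* ℂˣ), Continuous (fun x => ((χ₁ x : ℂˣ) : ℂ)) ∧ Continuous (fun x => ((χ₂ x : ℂˣ) : ℂ)) ∧ (UnitaryGroup.cmPrincipalSeries L 3 v (UnitaryGroup.cmTorusCharPair L v χ₁ χ₂)).IsIrreducible ∧ π.IsConstituentOf (UnitaryGroup.cmPrincipalSeries L 3 v (UnitaryGroup.cmTorusCharPair L v χ₁ χ₂))) →  -- hIrr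
          (∀ ξ' : ((UnitaryGroup.cmDatum L 2 (Matrix.of fun i j : Fin 2 => if i.val + j.val + 1 = 2 then (1 : L) else 0)).Local v × (UnitaryGroup.cmDatum L 1 (Matrix.of fun i j : Fin 1 => if i.val + j.val + 1 = 1 then (1 : L) else 0)).Local v) →* ℂˣ, (𝔇.pi2 ξ').IsSquareIntegrable 𝔇.μGZ ∧ ¬ (𝔇.piN ξ').IsSquareIntegrable 𝔇.μGZ) →  -- hKeys
          𝔇.DetNotL2 →  -- hDet
          𝔇.PacketCharHRegularity →  -- hM1H
          (∀ ψ' : ↥(Subgroup.center (Gqs L v)) →* ℂˣ, Continuous ψ' → 𝔇.IsL2 (𝔇.stG ψ')) →  -- hStL2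
          𝔇.cartanG = Sell →  -- eCartanG
          (∀ T' : Subgroup (Gqs L v), 𝔇.μT T' = μTf T') →  -- eMuT
          𝔇.cartanH = SH →  -- eCartanH
          (∀ T' : Subgroup ((UnitaryGroup.cmDatum L 2 (Matrix.of fun i j : Fin 2 => if i.val + j.val + 1 = 2 then (1 : L) else 0)).Local v × (UnitaryGroup.cmDatum L 1 (Matrix.of fun i j : Fin 1 => if i.val + j.val + 1 = 1 then (1 : L) else 0)).Local v), 𝔇.μTH T' = μTHf T') →  -- eMuTH
          (∀ a : ((UnitaryGroup.cmDatum L 2 (Matrix.of fun i j : Fin 2 => if i.val + j.val + 1 = 2 then (1 : L) else 0)).Local v × (UnitaryGroup.cmDatum L 1 (Matrix.of fun i j : Fin 1 => if i.val + j.val + 1 = 1 then (1 : L) else 0)).Local v), a ∈ 𝔇.regH ↔ IsLocalGRegular L v a) →  -- eRegH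
          (∀ a : ((UnitaryGroup.cmDatum L 2 (Matrix.of fun i j : Fin 2 => if i.val + j.val + 1 = 2 then (1 : L) else 0)).Local v × (UnitaryGroup.cmDatum L 1 (Matrix.of fun i j : Fin 1 => if i.val + j.val + 1 = 1 then (1 : L) else 0)).Local v), a ∈ 𝔇.ellH ↔ IsLocalGRegular L v a ∧ IsCompact ((Subgroup.centralizer ({a} : Set ((UnitaryGroup.cmDatum L 2 (Matrix.of fun i j : Fin 2 => if i.val + j.val + 1 = 2 then (1 : L) else 0)).Local v × (UnitaryGroup.cmDatum L 1 (Matrix.of fun i j : Fin 1 => if i.val + j.val + 1 = 1 then (1 : L) else 0)).Local v)) : Subgroup ((UnitaryGroup.cmDatum L 2 (Matrix.of fun i j : Fin 2 => if i.val + j.val + 1 = 2 then (1 : L) else 0)).Local v × (UnitaryGroup.cmDatum L 1 (Matrix.of fun i j : Fin 1 => if i.val + j.val + 1 = 1 then (1 : L) else 0)).Local v)) : Set ((UnitaryGroup.cmDatum L 2 (Matrix.of fun i j : Fin 2 => if i.val + j.val + 1 = 2 then (1 : L) else 0)).Local v × (UnitaryGroup.cmDatum L 1 (Matrix.of fun i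 j : Fin 1 => if i.val + j.val + 1 = 1 then (1 : L) else 0)).Local v))) →  -- eEllH
          𝔇.sqPacketsH = {({πSt} : Finset (IrrClass ((UnitaryGroup.cmDatum L 2 (Matrix.of fun i j : Fin 2 => if i.val + j.val + 1 = 2 then (1 : L) else 0)).Local v × (UnitaryGroup.cmDatum L 1 (Matrix.of fun i j : Fin 1 => if i.val + j.val + 1 = 1 then (1 : L) else 0)).Local v)))} →  -- eSq
          (∀ π : IrrClass (Gqs L v), (∃ (χ₁ : (UnitaryGroup.LocalRing L v)ˣ →* ℂˣ) (χ₂ : ↥(normOneUnits (conjLocal L (IsCMField.complexConj L) v)) →* ℂˣ), Continuous (fun x => ((χ₁ x : ℂˣ) : ℂ)) ∧ Continuous (fun x => ((χ₂ x : ℂˣ) : ℂ)) ∧ (UnitaryGroup.cmPrincipalSeries L 3 v (UnitaryGroup.cmTorusCharPair L v χ₁ χ₂)).IsIrreducible ∧ π.IsConstituentOf (UnitaryGroup.cmPrincipalSeries L 3 v (UnitaryGroup.cmTorusCharPair L v χ₁ χ₂))) → π ∈ 𝔇.irredPS) →  -- eIrr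
          (∀ (η₁ η₂ : ↥(normOneUnits (conjLocal L (IsCMField.complexConj L) v)) →* ℂˣ), Continuous (fun x => ((η₁ x : ℂˣ) : ℂ)) → Continuous (fun x => ((η₂ x : ℂˣ) : ℂ)) → ∀ ξ' : ((UnitaryGroup.cmDatum L 2 (Matrix.of fun i j : Fin 2 => if i.val + j.val + 1 = 2 then (1 : L) else 0)).Local v × (UnitaryGroup.cmDatum L 1 (Matrix.of fun i j : Fin 1 => if i.val + j.val + 1 = 1 then (1 : L) else 0)).Local v) →* ℂˣ, (∀ hh : ((UnitaryGroup.cmDatum L 2 (Matrix.of fun i j : Fin 2 => if i.val + j.val + 1 = 2 then (1 : L) else 0)).Local v × (UnitaryGroup.cmDatum L 1 (Matrix.of fun i j : Fin 1 => if i.val + j.val + 1 = 1 then (1 : L) else 0)).Local v), ξ' hh = η₁ (localDet (IsCMField.complexConj L) v (isUnit_antidiagOne_det L 2) hh.1) * η₂ (localDet (IsCMField.complexConj L) v (isUnit_antidiagOne_det L 2) hh.1 * localDet (IsCMField.complexConj L) v (isUnit_antidiagOne_det L 1) hh.2)) → KeysCaseTwoLabels L v (μ.semilocalComponent L v) η₁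 η₂ (𝔇.pi2 ξ') (𝔇.piN ξ')) →  -- eLab
          (∀ ρ : IrrClass ((UnitaryGroup.cmDatum L 2 (Matrix.of fun i j : Fin 2 => if i.val + j.val + 1 = 2 then (1 : L) else 0)).Local v × (UnitaryGroup.cmDatum L 1 (Matrix.of fun i j : Fin 1 => if i.val + j.val + 1 = 1 then (1 : L) else 0)).Local v), 𝔇.charH ρ = 𝔇.charH πSt) →  -- eCharH
          (∃ (ιZ : ↥(normOneUnits (conjLocal L (IsCMField.complexConj L) v)) →* ↥(Subgroup.center (Gqs L v))) (detZ : (Gqs L v) →* ↥(Subgroup.center (Gqs L v))), Continuous ιZ ∧ Continuous detZ ∧ (∀ z : ↥(normOneUnits (conjLocal L (IsCMField.complexConj L) v)), ((ιZ z).val.val.val : Matrix (Fin 3) (Fin 3) (UnitaryGroup.LocalRing L v)) = (((z : (UnitaryGroup.LocalRing L v)ˣ) : UnitaryGroup.LocalRing L v)) • (1 : Matrix (Fin 3) (Fin 3) (UnitaryGroup.LocalRing L v))) ∧ (∀ g : (Gqs L v), ((detZ g).val.val.val : Matrix (Fin 3) (Fin 3) (UnitaryGroup.LocalRing L v)) =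 (g.val.val : Matrix (Fin 3) (Fin 3) (UnitaryGroup.LocalRing L v)).det • (1 : Matrix (Fin 3) (Fin 3) (UnitaryGroup.LocalRing L v))) ∧ ∀ ψ : ↥(Subgroup.center (Gqs L v)) →* ℂˣ, Continuous ψ → (∃ hopen : IsOpen (((ψ.comp detZ).ker : Subgroup (Gqs L v)) : Set (Gqs L v)), 𝔇.detG ψ = IrrClass.mk (SmoothIrrep.ofChar (ψ.comp detZ) hopen)) ∧ 𝔇.stG ψ ≠ 𝔇.detG ψ ∧ (∀ c : IrrClass (Gqs L v), c.IsConstituentOf (cmPrincipalSeries L 3 v (cmTorusCharPair L v (halfModulusChar (UnitaryGroup.LocalRing L v) * halfModulusChar (UnitaryGroup.LocalRing L v))⁻¹ (ψ.comp ιZ))) ↔ (c = 𝔇.stG ψ ∨ c = 𝔇.detG ψ)) ∧ (𝔇.stG ψ).IsSquareIntegrable μZ ∧ ¬ (𝔇.detG ψ).IsSquareIntegrable μZ) →  -- eSt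
          ((∀ α : ((UnitaryGroup.cmDatum L 2 (Matrix.of fun i j : Fin 2 => if i.val + j.val + 1 = 2 then (1 : L) else 0)).Local v × (UnitaryGroup.cmDatum L 1 (Matrix.of fun i j : Fin 1 => if i.val + j.val + 1 = 1 then (1 : L) else 0)).Local v) → ℂ, Measurable α → Ch12Sec5.IsStableClassFunOn 𝔇.stConjH 𝔇.regH α → ∀ f ∈ SchwartzBruhat (Gqs L v), ∀ fH : ((UnitaryGroup.cmDatum L 2 (Matrix.of fun i j : Fin 2 => if i.val + j.val + 1 = 2 then (1 : L) else 0)).Local v × (UnitaryGroup.cmDatum L 1 (Matrix.of fun i j : Fin 1 => if i.val + j.val + 1 = 1 then (1 : L) else 0)).Local v) → ℂ, 𝔇.IsTransfer f fH → Integrable (fun g => f g * 𝔇.up α g) 𝔇.μG → Integrable (fun h => fH h * α h) 𝔇.μH → ∫ g, f g * 𝔇.up α g ∂𝔇.μG = ∫ h, fH h * α h ∂𝔇.μH) ∧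
           𝔇.Prop1252 ∧
           Ch12Sec6.PseudoCoeffExists 𝔇 ∧
           Ch12Sec6.Prop1261a 𝔇 ∧
           Ch12Sec6.Prop1261b 𝔇 ∧
           Ch12Sec6.Prop1261c 𝔇 ∧
           Ch12Sec6.EllipticOfNotPrincipalSeries 𝔇 ∧
           𝔇.PacketCharHNorm ∧
           𝔇.LdsPseudoCoeffTraceH ({πSt} : Finset (IrrClass (((UnitaryGroup.cmDatum L 2 (Matrix.of fun i j : Fin 2 => if i.val + j.val + 1 = 2 then (1 : L) else 0)).Local v × (UnitaryGroup.cmDatum L 1 (Matrix.of fun i j : Fin 1 => if i.val + j.val + 1 = 1 then (1 : L) else 0)).Local v)))) ∧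
           ∃ d : IrrClass (Gqs L v) → ℝ, (∀ (π : IrrClass (Gqs L v)) (f : Gqs L v → ℂ), 𝔇.IsL2 π → 𝔇.IsPseudoCoeff π f → f 1 = (d π : ℂ)) ∧ (∀ π : IrrClass (Gqs L v), 𝔇.IsL2 π → 0 < d π))) →
      ∃ (𝔇 : Ch12Sec5.EllipticData (Gqs L v) (((UnitaryGroup.cmDatum L 2 (Matrix.of fun i j : Fin 2 => if i.val + j.val + 1 = 2 then (1 : L) else 0)).Local v × (UnitaryGroup.cmDatum L 1 (Matrix.of fun i j : Fin 1 => if i.val + j.val + 1 = 1 then (1 : L) else 0)).Local v))) (d : IrrClass (Gqs L v) → ℝ) (T : Subgroup (Gqs L v))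
        (par : IrrClass (Gqs L v) → (((UnitaryGroup.LocalRing L v)ˣ →* ℂˣ) × (↥(normOneUnits (conjLocal L (IsCMField.complexConj L) v)) →* ℂˣ))) (μv : (UnitaryGroup.LocalRing L v)ˣ →* ℂˣ),
        𝔇.μG = νQv ∧  -- hC01
        𝔇.μH = νHv ∧  -- hC02
        𝔇.μGZ = μZ ∧  -- hC03
        𝔇.orb = mQv ∧  -- hC04
        (∀ γ : Gqs L v, γ ∈ 𝔇.regG ↔ IsRegularElt (γ.val : GL (Fin 3) (UnitaryGroup.LocalRing L v))) ∧  -- hC05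
        (∀ (φ : Gqs L v → ℂ) (fH : ((UnitaryGroup.cmDatum L 2 (Matrix.of fun i j : Fin 2 => if i.val + j.val + 1 = 2 then (1 : L) else 0)).Local v × (UnitaryGroup.cmDatum L 1 (Matrix.of fun i j : Fin 1 => if i.val + j.val + 1 = 1 then (1 : L) else 0)).Local v) → ℂ), 𝔇.IsTransfer φ fH ↔ IsLocalDeltaTransfer L (qsForm L) v ((finExplicitCollection L (qsForm L) μ (finExplicitDelta_conj_left_all L (qsForm L) μ) (finExplicitDelta_conj_right_all L (qsForm L) μ)) v) mHv mQv fH φ) ∧  -- hC06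
        ({πSt} : Finset (IrrClass (((UnitaryGroup.cmDatum L 2 (Matrix.of fun i j : Fin 2 => if i.val + j.val + 1 = 2 then (1 : L) else 0)).Local v × (UnitaryGroup.cmDatum L 1 (Matrix.of fun i j : Fin 1 => if i.val + j.val + 1 = 1 then (1 : L) else 0)).Local v)))) ∈ 𝔇.sqPacketsH ∧  -- hC07
        (∀ γ : Gqs L v, γ ∈ 𝔇.ellG ↔ IsRegularElt (γ.val : GL (Fin 3) (UnitaryGroup.LocalRing L v)) ∧ γ ∉ hyperbolicSet L v) ∧  -- hE
        (∀ π : IrrClass (Gqs L v), Measurable (𝔇.char π) ∧ LocallyIntegrable (𝔇.char π) 𝔇.μG ∧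
          (∀ x ∈ 𝔇.regG, ∀ᶠ y in 𝓝 x, 𝔇.char π y = 𝔇.char π x) ∧
          ∀ φ : Gqs L v → ℂ, IsLocSmooth φ → π.smoothTrace 𝔇.μG φ = ∫ x, φ x * 𝔇.char π x ∂𝔇.μG) ∧  -- hchar
        (∀ T : Subgroup (Gqs L v), T ∈ 𝔇.cartanAll ↔ T = (cmBorelTriple L 3 v).M ∨ T ∈ 𝔇.cartanG) ∧  -- hAll
        (𝔇.μT (cmBorelTriple L 3 v).M).IsHaarMeasure ∧  -- hHaar
        (∀ T ∈ 𝔇.cartanG, IsCompact (T : Set (Gqs L v)) ∧ ∃ γ₀ : Gqs L v, IsRegularElt (γ₀.val : GL (Fin 3) (UnitaryGroup.LocalRing L v)) ∧ T = Subgroup.centralizer ({γ₀} : Set (Gqs L v))) ∧  -- hcart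
        (∀ T ∈ 𝔇.cartanG, (𝔇.μT T).IsHaarMeasure) ∧  -- hHaarG
        (∀ T ∈ 𝔇.cartanG, IsFiniteMeasure (𝔇.μT T)) ∧  -- hfinG
        (∀ T ∈ 𝔇.cartanG, ∃ s : Finset (Subgroup ↥T), (∀ K ∈ s, IsClosed (K : Set ↥T) ∧ ¬ IsOpen (K : Set ↥T)) ∧ ∀ t : ↥T, ¬ IsRegularElt ((t : Gqs L v).val : GL (Fin 3) (UnitaryGroup.LocalRing L v)) → ∃ K ∈ s, t ∈ K) ∧  -- hker
        (∀ g : Gqs L v, 𝔇.DG g = ((NNReal.sqrt (NNReal.sqrt ((∏ w : PlacesOver L v, IsNonarchimedeanLocalField.normAbs (w.1.adicCompletion L) (((g.val : GL (Fin 3) (UnitaryGroup.LocalRing L v)).val.charpoly.discr) w)) * ((∏ w : PlacesOver L v, IsNonarchimedeanLocalField.normAbs (w.1.adicCompletion L) (((g.val : GL (Fin 3) (UnitaryGroup.LocalRing L v)).val.det) w)) ^ 2)⁻¹)) : ℝ≥0) : ℝ)) ∧  -- eDG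
        (∀ s : ((UnitaryGroup.cmDatum L 2 (Matrix.of fun i j : Fin 2 => if i.val + j.val + 1 = 2 then (1 : L) else 0)).Local v × (UnitaryGroup.cmDatum L 1 (Matrix.of fun i j : Fin 1 => if i.val + j.val + 1 = 1 then (1 : L) else 0)).Local v), 𝔇.DH s = ((NNReal.sqrt (NNReal.sqrt ((∏ w : PlacesOver L v, IsNonarchimedeanLocalField.normAbs (w.1.adicCompletion L) (((s.1.val : GL (Fin 2) (UnitaryGroup.LocalRing L v)).val.charpoly.discr) w)) * (∏ w : PlacesOver L v, IsNonarchimedeanLocalField.normAbs (w.1.adicCompletion L) (((s.1.val : GL (Fin 2) (UnitaryGroup.LocalRing L v)).val.det) w))⁻¹)) : ℝ≥0) : ℝ)) ∧  -- eDH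
        (∀ T ∈ 𝔇.cartanH, IsCompact (T : Set ((UnitaryGroup.cmDatum L 2 (Matrix.of fun i j : Fin 2 => if i.val + j.val + 1 = 2 then (1 : L) else 0)).Local v × (UnitaryGroup.cmDatum L 1 (Matrix.of fun i j : Fin 1 => if i.val + j.val + 1 = 1 then (1 : L) else 0)).Local v))) ∧  -- hKH
        (∀ T ∈ 𝔇.cartanH, IsFiniteMeasure (𝔇.μTH T)) ∧  -- hFH
        (∀ ρ ∈ 𝔇.sqPacketsH, ∀ T ∈ 𝔇.cartanH, ∀ C : Set ((UnitaryGroup.cmDatum L 2 (Matrix.of fun i j : Fin 2 => if i.val + j.val + 1 = 2 then (1 : L) else 0)).Local v × (UnitaryGroup.cmDatum L 1 (Matrix.of fun i j : Fin 1 => if i.val + j.val + 1 = 1 then (1 : L) else 0)).Local v), IsCompact C → C ⊆ (T : Set ((UnitaryGroup.cmDatum L 2 (Matrix.of fun i j : Fin 2 => if i.val + j.val + 1 = 2 then (1 : L) else 0)).Local v × (UnitaryGroup.cmDatum L 1 (Matrix.of fun i j : Fin 1 => if i.val + j.val + 1 = 1 then (1 : L) else 0)).Local v)) → ∃ B : ℝ,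 ∀ γ ∈ C, ‖(𝔇.DH γ : ℂ) * 𝔇.packetCharH ρ γ‖ ≤ B) ∧  -- hHBH
        (∀ π : IrrClass (Gqs L v), ¬ π.IsSquareIntegrable μZ → π.IsConstituentOf (UnitaryGroup.cmPrincipalSeries L 3 v (UnitaryGroup.cmTorusCharPair L v (par π).1 (par π).2)) ∧ Continuous (par π).1 ∧ Continuous (par π).2) ∧  -- hNL
        (∀ π : IrrClass (Gqs L v), (∃ (χ₁ : (UnitaryGroup.LocalRing L v)ˣ →* ℂˣ) (χ₂ : ↥(normOneUnits (conjLocal L (IsCMField.complexConj L) v)) →* ℂˣ), Continuous (fun x => ((χ₁ x : ℂˣ) : ℂ)) ∧ Continuous (fun x => ((χ₂ x : ℂˣ) : ℂ)) ∧ (UnitaryGroup.cmPrincipalSeries L 3 v (UnitaryGroup.cmTorusCharPair L v χ₁ χ₂)).IsIrreducible ∧ π.IsConstituentOf (UnitaryGroup.cmPrincipalSeries L 3 v (UnitaryGroup.cmTorusCharPair L v χ₁ χ₂))) → (UnitaryGroup.cmPrincipalSeries L 3 v (UnitaryGroup.cmTorusCharPair L v (par π).1 (par π).2)).IsIrreducible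 ∧ π.IsConstituentOf (UnitaryGroup.cmPrincipalSeries L 3 v (UnitaryGroup.cmTorusCharPair L v (par π).1 (par π).2)) ∧ Continuous (par π).1 ∧ Continuous (par π).2 ∧ Continuous (fun x => (((par π).1 x : ℂˣ) : ℂ)) ∧ Continuous (fun x => (((par π).2 x : ℂˣ) : ℂ)) ∧ ∀ (ν : Measure (Gqs L v)) (f : Gqs L v → ℂ), π.smoothTrace ν f = Representation.smoothTrace (G := Gqs L v) (UnitaryGroup.cmPrincipalSeries L 3 v (UnitaryGroup.cmTorusCharPair L v (par π).1 (par π).2)) ν f) ∧  -- hPSpar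
        (∀ P : Finset (IrrClass (Gqs L v)), P ∈ 𝔇.ldsPackets ↔ (P.card = 2 ∧ ∃ (χ₁ : (UnitaryGroup.LocalRing L v)ˣ →* ℂˣ) (χ₂ : ↥(normOneUnits (conjLocal L (IsCMField.complexConj L) v)) →* ℂˣ), Continuous (fun x => ((χ₁ x : ℂˣ) : ℂ)) ∧ Continuous (fun x => ((χ₂ x : ℂˣ) : ℂ)) ∧ (∀ a : (UnitaryGroup.LocalRing L v)ˣ, (conjLocal L (IsCMField.complexConj L) v) (a : UnitaryGroup.LocalRing L v) = a → χ₁ a = 1) ∧ χ₁ ≠ 1 ∧ ∀ c : IrrClass (Gqs L v), c ∈ P ↔ c.IsConstituentOf (UnitaryGroup.cmPrincipalSeries L 3 v (UnitaryGroup.cmTorusCharPair L v χ₁ χ₂)))) ∧  -- hLdsF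
        (∀ (χ₁ : (UnitaryGroup.LocalRing L v)ˣ →* ℂˣ) (χ₂ : ↥(normOneUnits (conjLocal L (IsCMField.complexConj L) v)) →* ℂˣ), Continuous (fun x => ((χ₁ x : ℂˣ) : ℂ)) → Continuous (fun x => ((χ₂ x : ℂˣ) : ℂ)) → ∀ π π' : IrrClass (Gqs L v), ¬ π.IsSquareIntegrable μZ → ¬ π'.IsSquareIntegrable μZ → π.IsConstituentOf (UnitaryGroup.cmPrincipalSeries L 3 v (UnitaryGroup.cmTorusCharPair L v χ₁ χ₂)) → π'.IsConstituentOf (UnitaryGroup.cmPrincipalSeries L 3 v (UnitaryGroup.cmTorusCharPair L v χ₁ χ₂)) → par π = par π') ∧  -- hW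
        UnitaryGroup.IsQuadraticCharExtension (conjLocal L (IsCMField.complexConj L) v) μv ∧  -- hμq
        (Continuous (fun x => ((μv x : ℂˣ) : ℂ))) ∧  -- hμc
        (∀ a b : ((UnitaryGroup.cmDatum L 2 (Matrix.of fun i j : Fin 2 => if i.val + j.val + 1 = 2 then (1 : L) else 0)).Local v × (UnitaryGroup.cmDatum L 1 (Matrix.of fun i j : Fin 1 => if i.val + j.val + 1 = 1 then (1 : L) else 0)).Local v), 𝔇.stConjH a b ↔ IsLocalStablyConjH L v a b) ∧  -- hStH
        (∀ a : ((UnitaryGroup.cmDatum L 2 (Matrix.of fun i j : Fin 2 => if i.val + j.val + 1 = 2 then (1 : L) else 0)).Local v × (UnitaryGroup.cmDatum L 1 (Matrix.of fun i j : Fin 1 => if i.val + j.val + 1 = 1 then (1 : L) else 0)).Local v), IsLocalGRegular L v a → a ∈ 𝔇.regH) ∧  -- hRegH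
        (∀ (α : ((UnitaryGroup.cmDatum L 2 (Matrix.of fun i j : Fin 2 => if i.val + j.val + 1 = 2 then (1 : L) else 0)).Local v × (UnitaryGroup.cmDatum L 1 (Matrix.of fun i j : Fin 1 => if i.val + j.val + 1 = 1 then (1 : L) else 0)).Local v) → ℂ) (x : Gqs L v), 𝔇.up α x = if IsRegularElt (x.val : GL (Fin 3) (UnitaryGroup.LocalRing L v)) then ((𝔇.DG x : ℂ))⁻¹ * ∑ᶠ q : Quot (IsLocalStablyConjH L v), (if IsLocalGRegular L v q.out ∧ IsLocalNormPair L (qsForm L) v q.out x then finTau L v q.out μ * (𝔇.DH q.out : ℂ) * ((finKappaAt L v (qsForm L) q.out x : ℤ) : ℂ) * α q.out else 0) else 0) ∧  -- hUp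
        (∀ ρ ∈ 𝔇.sqPacketsH, ∀ C : Set ((UnitaryGroup.cmDatum L 2 (Matrix.of fun i j : Fin 2 => if i.val + j.val + 1 = 2 then (1 : L) else 0)).Local v × (UnitaryGroup.cmDatum L 1 (Matrix.of fun i j : Fin 1 => if i.val + j.val + 1 = 1 then (1 : L) else 0)).Local v), IsCompact C → ∃ B : ℝ, ∀ s ∈ C, IsLocalGRegular L v s → ‖(𝔇.DH s : ℂ) * 𝔇.packetCharH ρ s‖ ≤ B) ∧  -- hHBHP
        (∃ (c : ℝ) (_ : c ≠ 0) (ι : Type) (S : Finset ι) (Λ : ι → ((Gqs L v) → ℂ) → ℂ) (Γ : ι → (Gqs L v) → ℂ) (γseq : ℕ → Gqs L v) (q : ℂ) (a : ι → ℕ) (g : ι → ℂ), (∀ f : (Gqs L v) → ℂ, IsLocSmooth f → ∀ᶠ γ in 𝓝[((T : Set (Gqs L v)) ∩ {γ | IsRegularElt (γ.val : GL (Fin 3) (UnitaryGroup.LocalRing L v))})] (1 : Gqs L v), classOrbitalIntegral mQv f (ConjClasses.mk γ) = (c : ℂ) * f 1 + ∑ u ∈ S, Λ u f * Γ u γ)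 ∧ (∀ n, γseq n ∈ (T : Set (Gqs L v)) ∧ IsRegularElt ((γseq n).val : GL (Fin 3) (UnitaryGroup.LocalRing L v))) ∧ Tendsto γseq atTop (𝓝 (1 : Gqs L v)) ∧ 1 < ‖q‖ ∧ (∀ u ∈ S, 1 ≤ a u) ∧ ∀ u ∈ S, ∀ n, Γ u (γseq n) = q ^ (n * a u) * g u) ∧  -- hGerm
        (∀ ξ' : ((UnitaryGroup.cmDatum L 2 (Matrix.of fun i j : Fin 2 => if i.val + j.val + 1 = 2 then (1 : L) else 0)).Local v × (UnitaryGroup.cmDatum L 1 (Matrix.of fun i j : Fin 1 => if i.val + j.val + 1 = 1 then (1 : L) else 0)).Local v) →* ℂˣ, Continuous ξ' → ∃ (η₁ η₂ : ↥(normOneUnits (conjLocal L (IsCMField.complexConj L) v)) →* ℂˣ), Continuous (fun x => ((η₁ x : ℂˣ) : ℂ)) ∧ Continuous (fun x => ((η₂ x : ℂˣ) : ℂ)) ∧ KeysCaseTwoLabels L v μv η₁ η₂ (𝔇.pi2 ξ') (𝔇.piN ξ')) ∧  -- hlabels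
        (∀ ψ' : ↥(Subgroup.center (Gqs L v)) →* ℂˣ, Continuous ψ' → ∃ ψ : ↥(normOneUnits (conjLocal L (IsCMField.complexConj L) v)) →* ℂˣ, Continuous ψ ∧ 𝔇.stG ψ' ≠ 𝔇.detG ψ' ∧ ∀ c : IrrClass (Gqs L v), c.IsConstituentOf (UnitaryGroup.cmPrincipalSeries L 3 v (UnitaryGroup.cmTorusCharPair L v (halfModulusChar (UnitaryGroup.LocalRing L v) * halfModulusChar (UnitaryGroup.LocalRing L v))⁻¹ ψ)) ↔ (c = 𝔇.stG ψ' ∨ c = 𝔇.detG ψ')) ∧  -- hSt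
        (∀ ψ₀ : ↥(normOneUnits (conjLocal L (IsCMField.complexConj L) v)) →* ℂˣ, Continuous (fun x => ((ψ₀ x : ℂˣ) : ℂ)) → ∃ ψ : ↥(Subgroup.center (Gqs L v)) →* ℂˣ, Continuous ψ ∧ ∀ c : IrrClass (Gqs L v), c.IsConstituentOf (UnitaryGroup.cmPrincipalSeries L 3 v (UnitaryGroup.cmTorusCharPair L v (halfModulusChar (UnitaryGroup.LocalRing L v) * halfModulusChar (UnitaryGroup.LocalRing L v))⁻¹ ψ₀)) ↔ (c = 𝔇.stG ψ ∨ c = 𝔇.detG ψ)) ∧  -- hStJH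
        (∀ (η₁ η₂ : ↥(normOneUnits (conjLocal L (IsCMField.complexConj L) v)) →* ℂˣ), Continuous (fun x => ((η₁ x : ℂˣ) : ℂ)) → Continuous (fun x => ((η₂ x : ℂˣ) : ℂ)) → ∃ ξ' : ((UnitaryGroup.cmDatum L 2 (Matrix.of fun i j : Fin 2 => if i.val + j.val + 1 = 2 then (1 : L) else 0)).Local v × (UnitaryGroup.cmDatum L 1 (Matrix.of fun i j : Fin 1 => if i.val + j.val + 1 = 1 then (1 : L) else 0)).Local v) →* ℂˣ, Continuous ξ' ∧ KeysCaseTwoLabels L v μv η₁ η₂ (𝔇.pi2 ξ') (𝔇.piN ξ')) ∧  -- hKeysJH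
        (∀ ρ ∈ 𝔇.sqPacketsH, ∀ a : ((UnitaryGroup.cmDatum L 2 (Matrix.of fun i j : Fin 2 => if i.val + j.val + 1 = 2 then (1 : L) else 0)).Local v × (UnitaryGroup.cmDatum L 1 (Matrix.of fun i j : Fin 1 => if i.val + j.val + 1 = 1 then (1 : L) else 0)).Local v), IsLocalGRegular L v a → ∀ᶠ a' in 𝓝 a, 𝔇.packetCharH ρ a' = 𝔇.packetCharH ρ a) ∧  -- hM1lc
        (∀ γ : Gqs L v, IsRegularElt (γ.val : GL (Fin 3) (UnitaryGroup.LocalRing L v)) → ∃ T' ∈ 𝔇.cartanAll, ∃ x : Gqs L v, ∀ g : Gqs L v, g ∈ Subgroup.centralizer ({γ} : Set (Gqs L v)) ↔ x⁻¹ * g * x ∈ T') ∧  -- hcovA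
        (∀ T' ∈ 𝔇.cartanAll, ∀ T'' ∈ 𝔇.cartanAll, T' ≠ T'' → ∀ y : Gqs L v, ¬ ∀ h : Gqs L v, h ∈ T'' ↔ y⁻¹ * h * y ∈ T') ∧  -- hncA
        (∀ T' ∈ 𝔇.cartanAll, T' ≠ (cmBorelTriple L 3 v).M → IsCompact (T' : Set (Gqs L v))) ∧  -- hcptA
        (∀ T' ∈ 𝔇.cartanAll, (𝔇.μT T').IsInvInvariant) ∧  -- hinvT
        (∀ T' ∈ 𝔇.cartanAll, 𝔇.μT T' (compactCore ↥T') = 1) ∧  -- hcoreT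
        (∀ π ∈ 𝔇.irredPS, ∃ (χ₁ : (UnitaryGroup.LocalRing L v)ˣ →* ℂˣ) (χ₂ : ↥(normOneUnits (conjLocal L (IsCMField.complexConj L) v)) →* ℂˣ), Continuous (fun x => ((χ₁ x : ℂˣ) : ℂ)) ∧ Continuous (fun x => ((χ₂ x : ℂˣ) : ℂ)) ∧ (UnitaryGroup.cmPrincipalSeries L 3 v (UnitaryGroup.cmTorusCharPair L v χ₁ χ₂)).IsIrreducible ∧ π.IsConstituentOf (UnitaryGroup.cmPrincipalSeries L 3 v (UnitaryGroup.cmTorusCharPair L v χ₁ χ₂))) ∧  -- hIrr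
        (∀ ξ' : ((UnitaryGroup.cmDatum L 2 (Matrix.of fun i j : Fin 2 => if i.val + j.val + 1 = 2 then (1 : L) else 0)).Local v × (UnitaryGroup.cmDatum L 1 (Matrix.of fun i j : Fin 1 => if i.val + j.val + 1 = 1 then (1 : L) else 0)).Local v) →* ℂˣ, (𝔇.pi2 ξ').IsSquareIntegrable 𝔇.μGZ ∧ ¬ (𝔇.piN ξ').IsSquareIntegrable 𝔇.μGZ) ∧  -- hKeys
        (∀ γ ∈ T, IsRegularElt (γ.val : GL (Fin 3) (UnitaryGroup.LocalRing L v)) → ∀ c : UnitaryGroup.LocalRing L v, ¬ ((γ.val.val : Matrix (Fin 3) (Fin 3) (UnitaryGroup.LocalRing L v)).charpoly).IsRoot c) ∧  -- hT3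
        𝔇.DetNotL2 ∧  -- hDet
        (∀ (χ₁ : (UnitaryGroup.LocalRing L v)ˣ →* ℂˣ) (χ₂ : ↥(normOneUnits (conjLocal L (IsCMField.complexConj L) v)) →* ℂˣ), Continuous (fun x => ((χ₁ x : ℂˣ) : ℂ)) → Continuous (fun x => ((χ₂ x : ℂˣ) : ℂ)) → (∃ N : Subrepresentation (UnitaryGroup.cmPrincipalSeries L 3 v (UnitaryGroup.cmTorusCharPair L v χ₁ χ₂)), N ≠ ⊥ ∧ N ≠ ⊤) → (χ₁ = halfModulusChar (UnitaryGroup.LocalRing L v) * halfModulusChar (UnitaryGroup.LocalRing L v) ∨ χ₁ = (halfModulusChar (UnitaryGroup.LocalRing L v) * halfModulusChar (UnitaryGroup.LocalRing L v))⁻¹) ∨ (∃ η : (UnitaryGroup.LocalRing L v)ˣ →* ℂˣ, IsQuadraticCharExtension (conjLocal L (IsCMField.complexConj L) v) η ∧ Continuous (fun x => ((η x : ℂˣ) : ℂ)) ∧ (χ₁ = η * halfModulusChar (UnitaryGroup.LocalRing L v) ∨ χ₁ = η * (halfModulusChar (UnitaryGroup.LocalRing L v))⁻¹)) ∨ (χ₁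 ≠ 1 ∧ ∀ a : (UnitaryGroup.LocalRing L v)ˣ, (conjLocal L (IsCMField.complexConj L) v) (a : UnitaryGroup.LocalRing L v) = a → χ₁ a = 1)) ∧  -- hKeysRed
        (∀ (χ₁ : (UnitaryGroup.LocalRing L v)ˣ →* ℂˣ) (χ₂ : ↥(normOneUnits (conjLocal L (IsCMField.complexConj L) v)) →* ℂˣ), Continuous (fun x => ((χ₁ x : ℂˣ) : ℂ)) → Continuous (fun x => ((χ₂ x : ℂˣ) : ℂ)) → (∀ a : (UnitaryGroup.LocalRing L v)ˣ, (conjLocal L (IsCMField.complexConj L) v) (a : UnitaryGroup.LocalRing L v) = a → χ₁ a = 1) → χ₁ ≠ 1 → ∃ P : Finset (IrrClass (Gqs L v)), P.card = 2 ∧ ∀ c : IrrClass (Gqs L v), c ∈ P ↔ c.IsConstituentOf (UnitaryGroup.cmPrincipalSeries L 3 v (UnitaryGroup.cmTorusCharPair L v χ₁ χ₂))) ∧  -- hLdsTwo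
        LocallyIntegrable (fun x : Gqs L v => (𝔇.DG x)⁻¹) 𝔇.μG ∧  -- hDGli
        (∀ α : ((UnitaryGroup.cmDatum L 2 (Matrix.of fun i j : Fin 2 => if i.val + j.val + 1 = 2 then (1 : L) else 0)).Local v × (UnitaryGroup.cmDatum L 1 (Matrix.of fun i j : Fin 1 => if i.val + j.val + 1 = 1 then (1 : L) else 0)).Local v) → ℂ, Measurable α → Ch12Sec5.IsStableClassFunOn 𝔇.stConjH 𝔇.regH α → ∀ f ∈ SchwartzBruhat (Gqs L v), ∀ fH : ((UnitaryGroup.cmDatum L 2 (Matrix.of fun i j : Fin 2 => if i.val + j.val + 1 = 2 then (1 : L) else 0)).Local v × (UnitaryGroup.cmDatum L 1 (Matrix.of fun i j : Fin 1 => if i.val + j.val + 1 = 1 then (1 : L) else 0)).Local v) → ℂ, 𝔇.IsTransfer f fH → Integrable (fun g => f g * 𝔇.up α g) 𝔇.μG → Integrable (fun h => fH h * α h) 𝔇.μH → ∫ g, f g * 𝔇.up α g ∂𝔇.μG = ∫ h, fH h * α h ∂𝔇.μH) ∧  -- hUpTr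
        𝔇.Prop1252 ∧  -- h1252
        Ch12Sec6.PseudoCoeffExists 𝔇 ∧  -- hPCE
        Ch12Sec6.Prop1261a 𝔇 ∧  -- h61a
        Ch12Sec6.Prop1261b 𝔇 ∧  -- h61b
        Ch12Sec6.Prop1261c 𝔇 ∧  -- h61c
        Ch12Sec6.EllipticOfNotPrincipalSeries 𝔇 ∧  -- hEllNotPS
        𝔇.PacketCharHRegularity ∧  -- hM1H
        𝔇.PacketCharHNorm ∧  -- hM5
        𝔇.LdsPseudoCoeffTraceH ({πSt} : Finset (IrrClass (((UnitaryGroup.cmDatum L 2 (Matrix.of fun i j : Fin 2 => if i.val + j.val + 1 = 2 then (1 : L) else 0)).Local v × (UnitaryGroup.cmDatum L 1 (Matrix.of fun i j : Fin 1 => if i.val + j.val + 1 = 1 then (1 : L) else 0)).Local v)))) ∧  -- hR0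
        (∀ ψ' : ↥(Subgroup.center (Gqs L v)) →* ℂˣ, Continuous ψ' → 𝔇.IsL2 (𝔇.stG ψ')) ∧  -- hStL2
        (∀ (π : IrrClass (Gqs L v)) (f : Gqs L v → ℂ), 𝔇.IsL2 π → 𝔇.IsPseudoCoeff π f → f 1 = (d π : ℂ)) ∧  -- hPL
        (∀ π : IrrClass (Gqs L v), 𝔇.IsL2 π → 0 < d π) ∧  -- hdpos
        normalizedCharacter_locallyBounded  -- hHCB
    := by
  intro L _ _ _ μ ξ v hns hμu hμω _ _ _ _ νHv νQv _ _ _ _ mHv mQv hcanH hcanQ hT_v π₁ πSt hlab hπ₁ _ _ μZ _ hHC hHCB T hT3 hGerm hKeysRed hLdsRedTwo hDGliO hBlock'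
  classical
  -- ★ INSTANTIATE-CARTAN: the Cartan data and their twelve binders
  obtain ⟨Sell, μTf, SH, μTHf, hcartO, hcovGO, hncGO, hHaarGO, hcoreGO, hinvGO, hHaarMO, hcoreMO, hinvMO, hKHO, hcovHO, hncHO, hHaarHO, hprobHO⟩ := F0P3cStCharTSRung0Cartan.exists_cartanInputs₂ L v hns
  have hBlock := hBlock' Sell μTf SH μTHf hcartO hcovGO hncGO hHaarGO hcoreGO hHaarMO hcoreMO hKHO hcovHO hncHO hHaarHO hprobHO
  -- keep the (large) goal out of the tactic state while the datum is built: argue by contradiction and produce the witness at the end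
  by_contra hneg
  letI : ∀ a : ((UnitaryGroup.cmDatum L 2 (Matrix.of fun i j : Fin 2 => if i.val + j.val + 1 = 2 then (1 : L) else 0)).Local v × (UnitaryGroup.cmDatum L 1 (Matrix.of fun i j : Fin 1 => if i.val + j.val + 1 = 1 then (1 : L) else 0)).Local v), MeasurableSpace (((UnitaryGroup.cmDatum L 2 (Matrix.of fun i j : Fin 2 => if i.val + j.val + 1 = 2 then (1 : L) else 0)).Local v × (UnitaryGroup.cmDatum L 1 (Matrix.of fun i j : Fin 1 => if i.val + j.val + 1 = 1 then (1 : L) else 0)).Local v) ⧸ Subgroup.centralizer ({a} : Set ((UnitaryGroup.cmDatum L 2 (Matrix.of fun i j : Fin 2 => if i.val + j.val + 1 = 2 then (1 : L) else 0)).Local v × (UnitaryGroup.cmDatum L 1 (Matrix.of fun i j : Fin 1 => if i.val + j.val + 1 = 1 then (1 : L) else 0)).Local v))) := fun _ => borel _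
  haveI : ∀ a : ((UnitaryGroup.cmDatum L 2 (Matrix.of fun i j : Fin 2 => if i.val + j.val + 1 = 2 then (1 : L) else 0)).Local v × (UnitaryGroup.cmDatum L 1 (Matrix.of fun i j : Fin 1 => if i.val + j.val + 1 = 1 then (1 : L) else 0)).Local v), BorelSpace (((UnitaryGroup.cmDatum L 2 (Matrix.of fun i j : Fin 2 => if i.val + j.val + 1 = 2 then (1 : L) else 0)).Local v × (UnitaryGroup.cmDatum L 1 (Matrix.of fun i j : Fin 1 => if i.val + j.val + 1 = 1 then (1 : L) else 0)).Local v) ⧸ Subgroup.centralizer ({a} : Set ((UnitaryGroup.cmDatum L 2 (Matrix.of fun i j : Fin 2 => if i.val + j.val + 1 = 2 then (1 : L) else 0)).Local v × (UnitaryGroup.cmDatum L 1 (Matrix.of fun i j : Fin 1 => if i.val + j.val + 1 = 1 then (1 : L) else 0)).Local v))) := fun _ => ⟨rfl⟩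
  letI : ∀ γ : Gqs L v, MeasurableSpace (Gqs L v ⧸ Subgroup.centralizer ({γ} : Set (Gqs L v))) := fun _ => borel _
  haveI : ∀ γ : Gqs L v, BorelSpace (Gqs L v ⧸ Subgroup.centralizer ({γ} : Set (Gqs L v))) := fun _ => ⟨rfl⟩
  letI : MeasurableSpace ((UnitaryGroup.cmDatum L 2 (Matrix.of fun i j : Fin 2 => if i.val + j.val + 1 = 2 then (1 : L) else 0)).Local v) := borel _
  haveI : BorelSpace ((UnitaryGroup.cmDatum L 2 (Matrix.of fun i j : Fin 2 => if i.val + j.val + 1 = 2 then (1 : L) else 0)).Local v) := ⟨rfl⟩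
  -- the place above `v`
  obtain ⟨w, hw⟩ : ∃ w : PlacesOver L v, IsCMField.complexConj L • w.1 = w.1 := let ⟨w⟩ := PlacesOver.nonempty L v; ⟨w, hns w⟩
  -- ★ S1 CHAR-FIELD: the character family (choice under §1.6)
  obtain ⟨char₀, hchar₀, -⟩ := F0P3cStCharTSCharField.exists_charFamily_charRegularity_Gqs L v hHC w hw (H' := ((UnitaryGroup.cmDatum L 2 (Matrix.of fun i j : Fin 2 => if i.val + j.val + 1 = 2 then (1 : L) else 0)).Local v × (UnitaryGroup.cmDatum L 1 (Matrix.of fun i j : Fin 1 => if i.val + j.val + 1 = 1 then (1 : L) else 0)).Local v)) νQv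
  -- ★ DG-FIELD: `D_G` by its closed formula; ★ DG-FIELD-TWO: `D_H = dg₂ ∘ pr₁` by the rank-2 closed formula and its two letters
  obtain ⟨DG₀, hDG₀⟩ : ∃ f : (Gqs L v) → ℝ, ∀ g : (Gqs L v), f g = ((NNReal.sqrt (NNReal.sqrt ((∏ w : PlacesOver L v, IsNonarchimedeanLocalField.normAbs (w.1.adicCompletion L) (((g.val : GL (Fin 3) (UnitaryGroup.LocalRing L v)).val.charpoly.discr) w)) * ((∏ w : PlacesOver L v, IsNonarchimedeanLocalField.normAbs (w.1.adicCompletion L) (((g.val : GL (Fin 3) (UnitaryGroup.LocalRing L v)).val.det) w)) ^ 2)⁻¹)) : ℝ≥0) : ℝ) := ⟨_, fun g => rfl⟩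
  obtain ⟨DG₂, hDG₂m, hDG₂0, hDG₂u⟩ := F0P3cStCharTSDGFieldTwo.exists_DG_field_two L v (Matrix.of fun i j : Fin 2 => if i.val + j.val + 1 = 2 then (1 : L) else 0)
  -- ★ ST-PIN: `stG`, `detG` (and the scalar ∕ determinant homomorphisms into the centre)
  obtain ⟨ιZ, detZ, detG₀, stG₀, hιc, hdetZc, hιval, hdetZval, hStψ, hStD⟩ := F0P3cStCharTSStPin.exists_stDetFields L v hns μZ
  -- ★ KEYS-FIELDS ∕ XI-DICT ∕ XI-SURJ ∕ KEYS-PAIRS: `pi2`, `piN` with their Keys labels and the pair clause (f)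
  obtain ⟨pi2₀, piN₀, hL2₀, hlabF₀, -, -, hlab₀, hpairs₀⟩ := F0P3cStCharTSXiSurj.exists_keysFields_Hv_pairs μ hμω v hns μZ
  -- ★ H-FIELDS-HCB: `χ_{St_H} = Θ` with its HC bound and the (M1H) clause
  obtain ⟨Θ, ⟨hΘm, hΘli, hΘlc, hΘtr⟩, hΘB, hM1H₀⟩ := F0P3cStCharTSHFieldsHcb.exists_charSt_packetCharHRegularity_hcb L v hHC hHCB w hw νHv _ _
    (F0P3cStCharTSHFields.continuous_psi_comp_localDet L v ξ.ψ) π₁ πSt hlab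
  -- ★ PAR-FIELD-W: the W-normalised parameter map
  obtain ⟨par, hNL₀, hPSpar, hW₀⟩ := F0P3cStCharTSParFieldW.exists_parField_W L v hns μZ
  -- ★ WITNESS: the datum with these fields
  obtain ⟨𝔇, hμG, hμH, hμGZ, horb, hregG, hTr, hmem, hellG, hcharE, hcharHE, hupE, hDGE, hDHE, -, -, hAllE, hcartanGE, hcartanHE,
      hμTE, hμTHE, hstGE, hdetGE, hpi2E, hpiNE, hsqE, hldsE, hirrE, hirrE', -, hstConjHE, hregHE, hellHE⟩ :=
    F0P3cStCharTSDatumWitness.exists_datum_with_fields L μ v νHv νQv μZ mHv mQv πSt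
      (1 : ((UnitaryGroup.cmDatum L 2 (Matrix.of fun i j : Fin 2 => if i.val + j.val + 1 = 2 then (1 : L) else 0)).Local v × (UnitaryGroup.cmDatum L 1 (Matrix.of fun i j : Fin 1 => if i.val + j.val + 1 = 1 then (1 : L) else 0)).Local v) →* (Gqs L v)) (fun _ _ => True) (fun a b : ((UnitaryGroup.cmDatum L 2 (Matrix.of fun i j : Fin 2 => if i.val + j.val + 1 = 2 then (1 : L) else 0)).Local v × (UnitaryGroup.cmDatum L 1 (Matrix.of fun i j : Fin 1 => if i.val + j.val + 1 = 1 then (1 : L) else 0)).Local v) => IsLocalStablyConjH L v a b)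
      {a : ((UnitaryGroup.cmDatum L 2 (Matrix.of fun i j : Fin 2 => if i.val + j.val + 1 = 2 then (1 : L) else 0)).Local v × (UnitaryGroup.cmDatum L 1 (Matrix.of fun i j : Fin 1 => if i.val + j.val + 1 = 1 then (1 : L) else 0)).Local v) | IsLocalGRegular L v a}
      {a : ((UnitaryGroup.cmDatum L 2 (Matrix.of fun i j : Fin 2 => if i.val + j.val + 1 = 2 then (1 : L) else 0)).Local v × (UnitaryGroup.cmDatum L 1 (Matrix.of fun i j : Fin 1 => if i.val + j.val + 1 = 1 then (1 : L) else 0)).Local v) | IsLocalGRegular L v a ∧ IsCompact ((Subgroup.centralizer ({a} : Set ((UnitaryGroup.cmDatum L 2 (Matrix.of fun i j : Fin 2 => if i.val + j.val + 1 = 2 then (1 : L) else 0)).Local v × (UnitaryGroup.cmDatum L 1 (Matrix.of fun i j : Fin 1 => if i.val + j.val + 1 = 1 then (1 : L) else 0)).Local v)) : Subgroup ((UnitaryGroup.cmDatum L 2 (Matrix.of fun i j : Fin 2 => if i.val + j.val + 1 = 2 then (1 : L) else 0)).Local v × (UnitaryGroup.cmDatum L 1 (Matrix.of fun i j : Fin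 1 => if i.val + j.val + 1 = 1 then (1 : L) else 0)).Local v)) : Set ((UnitaryGroup.cmDatum L 2 (Matrix.of fun i j : Fin 2 => if i.val + j.val + 1 = 2 then (1 : L) else 0)).Local v × (UnitaryGroup.cmDatum L 1 (Matrix.of fun i j : Fin 1 => if i.val + j.val + 1 = 1 then (1 : L) else 0)).Local v))}
      Sell SH DG₀ (fun h : ((UnitaryGroup.cmDatum L 2 (Matrix.of fun i j : Fin 2 => if i.val + j.val + 1 = 2 then (1 : L) else 0)).Local v × (UnitaryGroup.cmDatum L 1 (Matrix.of fun i j : Fin 1 => if i.val + j.val + 1 = 1 then (1 : L) else 0)).Local v) => DG₂ h.1) (fun h : ((UnitaryGroup.cmDatum L 2 (Matrix.of fun i j : Fin 2 => if i.val + j.val + 1 = 2 then (1 : L) else 0)).Local v × (UnitaryGroup.cmDatum L 1 (Matrix.of fun i j : Fin 1 => if i.val + j.val + 1 = 1 then (1 : L) else 0)).Local v) => finTau L v h μ) μTf μTHf char₀ (fun _ => Θ)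
      (fun (α : ((UnitaryGroup.cmDatum L 2 (Matrix.of fun i j : Fin 2 => if i.val + j.val + 1 = 2 then (1 : L) else 0)).Local v × (UnitaryGroup.cmDatum L 1 (Matrix.of fun i j : Fin 1 => if i.val + j.val + 1 = 1 then (1 : L) else 0)).Local v) → ℂ) (x : (Gqs L v)) => if IsRegularElt (x.val : GL (Fin 3) (UnitaryGroup.LocalRing L v)) then ((DG₀ x : ℂ))⁻¹ * ∑ᶠ q : Quot (IsLocalStablyConjH L v), (if IsLocalGRegular L v q.out ∧ IsLocalNormPair L (qsForm L) v q.out x then finTau L v q.out μ * (((fun h : ((UnitaryGroup.cmDatum L 2 (Matrix.of fun i j : Fin 2 => if i.val + j.val + 1 = 2 then (1 : L) else 0)).Local v × (UnitaryGroup.cmDatum L 1 (Matrix.of fun i j : Fin 1 => if i.val + j.val + 1 = 1 then (1 : L) else 0)).Local v) => DG₂ h.1) q.out : ℝ) : ℂ) * ((finKappaAt L v (qsForm L) q.out x : ℤ) : ℂ) * α q.out else 0) else 0)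
      stG₀ detG₀ pi2₀ piN₀
  -- the pins at the datum
  have hDGf : ∀ g : (Gqs L v), 𝔇.DG g = ((NNReal.sqrt (NNReal.sqrt ((∏ w : PlacesOver L v, IsNonarchimedeanLocalField.normAbs (w.1.adicCompletion L) (((g.val : GL (Fin 3) (UnitaryGroup.LocalRing L v)).val.charpoly.discr) w)) * ((∏ w : PlacesOver L v, IsNonarchimedeanLocalField.normAbs (w.1.adicCompletion L) (((g.val : GL (Fin 3) (UnitaryGroup.LocalRing L v)).val.det) w)) ^ 2)⁻¹)) : ℝ≥0) : ℝ) := fun g => by rw [hDGE]; exact hDG₀ g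
  have hSq : 𝔇.sqPacketsH = {({πSt} : Finset (IrrClass ((UnitaryGroup.cmDatum L 2 (Matrix.of fun i j : Fin 2 => if i.val + j.val + 1 = 2 then (1 : L) else 0)).Local v × (UnitaryGroup.cmDatum L 1 (Matrix.of fun i j : Fin 1 => if i.val + j.val + 1 = 1 then (1 : L) else 0)).Local v)))} := hsqE
  have hBnd : ∀ C : Set ((UnitaryGroup.cmDatum L 2 (Matrix.of fun i j : Fin 2 => if i.val + j.val + 1 = 2 then (1 : L) else 0)).Local v × (UnitaryGroup.cmDatum L 1 (Matrix.of fun i j : Fin 1 => if i.val + j.val + 1 = 1 then (1 : L) else 0)).Local v), IsCompact C → ∃ B : ℝ, ∀ s ∈ C, ‖(𝔇.DH s : ℂ) * 𝔇.charH πSt s‖ ≤ B := fun C hC => by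
    rw [hDHE, hcharHE]; exact hΘB DG₂ hDG₂0 hDG₂u C hC
  have hSD := hStD 𝔇 hstGE hdetGE hμGZ
  have hM1H : 𝔇.PacketCharHRegularity := hM1H₀ 𝔇 hμH (by rw [hcharHE]) (fun a => by rw [hregHE]; exact Iff.rfl)
    (fun a => by rw [hellHE]; exact Iff.rfl) hSq (by rw [hstConjHE, hregHE]; exact F0P3cStCharTSHstabHolds.hstab_holds L v hns νHv ξ π₁ πSt hlab hπ₁ Θ ⟨hΘm, hΘli, hΘlc, hΘtr⟩)
  have a_hC01 : 𝔇.μG = νQv := hμG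
  have a_hC02 : 𝔇.μH = νHv := hμH
  have a_hC03 : 𝔇.μGZ = μZ := hμGZ
  have a_hC04 : 𝔇.orb = mQv := horb
  have a_hC05 : (∀ γ : Gqs L v, γ ∈ 𝔇.regG ↔ IsRegularElt (γ.val : GL (Fin 3) (UnitaryGroup.LocalRing L v))) := hregG
  have a_hC06 : (∀ (φ : Gqs L v → ℂ) (fH : ((UnitaryGroup.cmDatum L 2 (Matrix.of fun i j : Fin 2 => if i.val + j.val + 1 = 2 then (1 : L) else 0)).Local v × (UnitaryGroup.cmDatum L 1 (Matrix.of fun i j : Fin 1 => if i.val + j.val + 1 = 1 then (1 : L) else 0)).Local v) → ℂ), 𝔇.IsTransfer φ fH ↔ IsLocalDeltaTransfer L (qsForm L) v ((finExplicitCollection L (qsForm L) μ (finExplicitDelta_conj_left_all L (qsForm L) μ) (finExplicitDelta_conj_right_all L (qsForm L) μ)) v) mHv mQv fH φ) := hTr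
  have a_hC07 : ({πSt} : Finset (IrrClass (((UnitaryGroup.cmDatum L 2 (Matrix.of fun i j : Fin 2 => if i.val + j.val + 1 = 2 then (1 : L) else 0)).Local v × (UnitaryGroup.cmDatum L 1 (Matrix.of fun i j : Fin 1 => if i.val + j.val + 1 = 1 then (1 : L) else 0)).Local v)))) ∈ 𝔇.sqPacketsH := hmem
  have a_hE : (∀ γ : Gqs L v, γ ∈ 𝔇.ellG ↔ IsRegularElt (γ.val : GL (Fin 3) (UnitaryGroup.LocalRing L v)) ∧ γ ∉ hyperbolicSet L v) := hellG
  have a_hchar : (∀ π : IrrClass (Gqs L v), Measurable (𝔇.char π) ∧ LocallyIntegrable (𝔇.char π) 𝔇.μG ∧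
          (∀ x ∈ 𝔇.regG, ∀ᶠ y in 𝓝 x, 𝔇.char π y = 𝔇.char π x) ∧
          ∀ φ : Gqs L v → ℂ, IsLocSmooth φ → π.smoothTrace 𝔇.μG φ = ∫ x, φ x * 𝔇.char π x ∂𝔇.μG) := (fun π => by rw [hcharE, hμG]; obtain ⟨h1, h2, h3, h4⟩ := hchar₀ π; exact ⟨h1, h2, fun x hx => h3 x ((hregG x).1 hx), h4⟩)
  have a_hAll : (∀ T : Subgroup (Gqs L v), T ∈ 𝔇.cartanAll ↔ T = (cmBorelTriple L 3 v).M ∨ T ∈ 𝔇.cartanG) := hAllE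
  have a_hHaar : (𝔇.μT (cmBorelTriple L 3 v).M).IsHaarMeasure := (by rw [hμTE]; exact hHaarMO)
  have a_hcart : (∀ T ∈ 𝔇.cartanG, IsCompact (T : Set (Gqs L v)) ∧ ∃ γ₀ : Gqs L v, IsRegularElt (γ₀.val : GL (Fin 3) (UnitaryGroup.LocalRing L v)) ∧ T = Subgroup.centralizer ({γ₀} : Set (Gqs L v))) := (by rw [hcartanGE]; exact hcartO)
  have a_hHaarG : (∀ T ∈ 𝔇.cartanG, (𝔇.μT T).IsHaarMeasure) := (fun T' hT' => by rw [hμTE]; rw [hcartanGE] at hT'; exact hHaarGO T' hT')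
  have a_hfinG : (∀ T ∈ 𝔇.cartanG, IsFiniteMeasure (𝔇.μT T)) := (F0P3cStCharTSCartanNullDischarge.isFiniteMeasure_of_compact_haar L v 𝔇 a_hcart a_hHaarG)
  have a_hker : (∀ T ∈ 𝔇.cartanG, ∃ s : Finset (Subgroup ↥T), (∀ K ∈ s, IsClosed (K : Set ↥T) ∧ ¬ IsOpen (K : Set ↥T)) ∧ ∀ t : ↥T, ¬ IsRegularElt ((t : Gqs L v).val : GL (Fin 3) (UnitaryGroup.LocalRing L v)) → ∃ K ∈ s, t ∈ K) := (F0P3cStCharTSCartanNullDischarge.rootKernels_of_compact_centralizers L v hns 𝔇 a_hcart)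
  have a_eDG : (∀ g : Gqs L v, 𝔇.DG g = ((NNReal.sqrt (NNReal.sqrt ((∏ w : PlacesOver L v, IsNonarchimedeanLocalField.normAbs (w.1.adicCompletion L) (((g.val : GL (Fin 3) (UnitaryGroup.LocalRing L v)).val.charpoly.discr) w)) * ((∏ w : PlacesOver L v, IsNonarchimedeanLocalField.normAbs (w.1.adicCompletion L) (((g.val : GL (Fin 3) (UnitaryGroup.LocalRing L v)).val.det) w)) ^ 2)⁻¹)) : ℝ≥0) : ℝ)) := hDGf
  have a_eDH : (∀ s : ((UnitaryGroup.cmDatum L 2 (Matrix.of fun i j : Fin 2 => if i.val + j.val + 1 = 2 then (1 : L) else 0)).Local v × (UnitaryGroup.cmDatum L 1 (Matrix.of fun i j : Fin 1 => if i.val + j.val + 1 = 1 then (1 : L) else 0)).Local v), 𝔇.DH s = ((NNReal.sqrt (NNReal.sqrt ((∏ w : PlacesOver L v, IsNonarchimedeanLocalField.normAbs (w.1.adicCompletion L) (((s.1.val : GL (Fin 2) (UnitaryGroup.LocalRing L v)).val.charpoly.discr) w)) * (∏ w : PlacesOver L v, IsNonarchimedeanLocalField.normAbs (w.1.adicCompletion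 L) (((s.1.val : GL (Fin 2) (UnitaryGroup.LocalRing L v)).val.det) w))⁻¹)) : ℝ≥0) : ℝ)) := (fun s => by rw [hDHE]; exact F0P3cStCharTSDHLc.DG₂_eq_dgFormulaTwo L v DG₂ hDG₂0 hDG₂u s.1)
  have a_hKH : (∀ T ∈ 𝔇.cartanH, IsCompact (T : Set ((UnitaryGroup.cmDatum L 2 (Matrix.of fun i j : Fin 2 => if i.val + j.val + 1 = 2 then (1 : L) else 0)).Local v × (UnitaryGroup.cmDatum L 1 (Matrix.of fun i j : Fin 1 => if i.val + j.val + 1 = 1 then (1 : L) else 0)).Local v))) := (by rw [hcartanHE]; exact fun T' hT' => (hKHO T' hT').1)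
  have a_hFH : (∀ T ∈ 𝔇.cartanH, IsFiniteMeasure (𝔇.μTH T)) := (fun T' hT' => by rw [hμTHE]; rw [hcartanHE] at hT'; haveI := hHaarHO T' hT'; haveI : CompactSpace ↥T' := isCompact_iff_compactSpace.1 (hKHO T' hT').1; infer_instance)
  have a_hHBH : (∀ ρ ∈ 𝔇.sqPacketsH, ∀ T ∈ 𝔇.cartanH, ∀ C : Set ((UnitaryGroup.cmDatum L 2 (Matrix.of fun i j : Fin 2 => if i.val + j.val + 1 = 2 then (1 : L) else 0)).Local v × (UnitaryGroup.cmDatum L 1 (Matrix.of fun i j : Fin 1 => if i.val + j.val + 1 = 1 then (1 : L) else 0)).Local v), IsCompact C → C ⊆ (T : Set ((UnitaryGroup.cmDatum L 2 (Matrix.of fun i j : Fin 2 => if i.val + j.val + 1 = 2 then (1 : L) else 0)).Local v × (UnitaryGroup.cmDatum L 1 (Matrix.of fun i j : Fin 1 => if i.val + j.val + 1 = 1 then (1 : L) else 0)).Local v)) → ∃ B : ℝ, ∀ γ ∈ C, ‖(𝔇.DH γ : ℂ) * 𝔇.packetCharH ρ γ‖ ≤ B) := (F0P3cStCharTSHcbH.hHBH_cartanH_of_compactBound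 𝔇 πSt hSq hBnd)
  have a_hNL : (∀ π : IrrClass (Gqs L v), ¬ π.IsSquareIntegrable μZ → π.IsConstituentOf (UnitaryGroup.cmPrincipalSeries L 3 v (UnitaryGroup.cmTorusCharPair L v (par π).1 (par π).2)) ∧ Continuous (par π).1 ∧ Continuous (par π).2) := hNL₀
  have a_hPSpar : (∀ π : IrrClass (Gqs L v), (∃ (χ₁ : (UnitaryGroup.LocalRing L v)ˣ →* ℂˣ) (χ₂ : ↥(normOneUnits (conjLocal L (IsCMField.complexConj L) v)) →* ℂˣ), Continuous (fun x => ((χ₁ x : ℂˣ) : ℂ)) ∧ Continuous (fun x => ((χ₂ x : ℂˣ) : ℂ)) ∧ (UnitaryGroup.cmPrincipalSeries L 3 v (UnitaryGroup.cmTorusCharPair L v χ₁ χ₂)).IsIrreducible ∧ π.IsConstituentOf (UnitaryGroup.cmPrincipalSeries L 3 v (UnitaryGroup.cmTorusCharPair L v χ₁ χ₂))) → (UnitaryGroup.cmPrincipalSeries L 3 v (UnitaryGroup.cmTorusCharPair L v (par π).1 (par π).2)).IsIrreducible ∧ π.IsConstituentOf (UnitaryGroup.cmPrincipalSeries L 3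 v (UnitaryGroup.cmTorusCharPair L v (par π).1 (par π).2)) ∧ Continuous (par π).1 ∧ Continuous (par π).2 ∧ Continuous (fun x => (((par π).1 x : ℂˣ) : ℂ)) ∧ Continuous (fun x => (((par π).2 x : ℂˣ) : ℂ)) ∧ ∀ (ν : Measure (Gqs L v)) (f : Gqs L v → ℂ), π.smoothTrace ν f = Representation.smoothTrace (G := Gqs L v) (UnitaryGroup.cmPrincipalSeries L 3 v (UnitaryGroup.cmTorusCharPair L v (par π).1 (par π).2)) ν f) := hPSpar
  have a_hLdsF : (∀ P : Finset (IrrClass (Gqs L v)), P ∈ 𝔇.ldsPackets ↔ (P.card = 2 ∧ ∃ (χ₁ : (UnitaryGroup.LocalRing L v)ˣ →* ℂˣ) (χ₂ : ↥(normOneUnits (conjLocal L (IsCMField.complexConj L) v)) →* ℂˣ), Continuous (fun x => ((χ₁ x : ℂˣ) : ℂ)) ∧ Continuous (fun x => ((χ₂ x : ℂˣ) : ℂ)) ∧ (∀ a : (UnitaryGroup.LocalRing L v)ˣ, (conjLocal L (IsCMField.complexConj L) v) (a : UnitaryGroup.LocalRing L v) = a → χ₁ a = 1) ∧ χ₁ ≠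 1 ∧ ∀ c : IrrClass (Gqs L v), c ∈ P ↔ c.IsConstituentOf (UnitaryGroup.cmPrincipalSeries L 3 v (UnitaryGroup.cmTorusCharPair L v χ₁ χ₂)))) := hldsE
  have a_hW : (∀ (χ₁ : (UnitaryGroup.LocalRing L v)ˣ →* ℂˣ) (χ₂ : ↥(normOneUnits (conjLocal L (IsCMField.complexConj L) v)) →* ℂˣ), Continuous (fun x => ((χ₁ x : ℂˣ) : ℂ)) → Continuous (fun x => ((χ₂ x : ℂˣ) : ℂ)) → ∀ π π' : IrrClass (Gqs L v), ¬ π.IsSquareIntegrable μZ → ¬ π'.IsSquareIntegrable μZ → π.IsConstituentOf (UnitaryGroup.cmPrincipalSeries L 3 v (UnitaryGroup.cmTorusCharPair L v χ₁ χ₂)) → π'.IsConstituentOf (UnitaryGroup.cmPrincipalSeries L 3 v (UnitaryGroup.cmTorusCharPair L v χ₁ χ₂)) → par π = par π') := hW₀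
  have a_hStH : (∀ a b : ((UnitaryGroup.cmDatum L 2 (Matrix.of fun i j : Fin 2 => if i.val + j.val + 1 = 2 then (1 : L) else 0)).Local v × (UnitaryGroup.cmDatum L 1 (Matrix.of fun i j : Fin 1 => if i.val + j.val + 1 = 1 then (1 : L) else 0)).Local v), 𝔇.stConjH a b ↔ IsLocalStablyConjH L v a b) := (fun a b => by rw [hstConjHE])
  have a_hRegH : (∀ a : ((UnitaryGroup.cmDatum L 2 (Matrix.of fun i j : Fin 2 => if i.val + j.val + 1 = 2 then (1 : L) else 0)).Local v × (UnitaryGroup.cmDatum L 1 (Matrix.of fun i j : Fin 1 => if i.val + j.val + 1 = 1 then (1 : L) else 0)).Local v), IsLocalGRegular L v a → a ∈ 𝔇.regH) := (fun a ha => by rw [hregHE]; exact ha)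
  have a_hUp : (∀ (α : ((UnitaryGroup.cmDatum L 2 (Matrix.of fun i j : Fin 2 => if i.val + j.val + 1 = 2 then (1 : L) else 0)).Local v × (UnitaryGroup.cmDatum L 1 (Matrix.of fun i j : Fin 1 => if i.val + j.val + 1 = 1 then (1 : L) else 0)).Local v) → ℂ) (x : Gqs L v), 𝔇.up α x = if IsRegularElt (x.val : GL (Fin 3) (UnitaryGroup.LocalRing L v)) then ((𝔇.DG x : ℂ))⁻¹ * ∑ᶠ q : Quot (IsLocalStablyConjH L v), (if IsLocalGRegular L v q.out ∧ IsLocalNormPair L (qsForm L) v q.out x then finTau L v q.out μ * (𝔇.DH q.out : ℂ) * ((finKappaAt L v (qsForm L) q.out x : ℤ) : ℂ) * α q.out else 0) else 0) := (fun α x => by rw [hupE, hDGE, hDHE])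
  have a_hHBHP : (∀ ρ ∈ 𝔇.sqPacketsH, ∀ C : Set ((UnitaryGroup.cmDatum L 2 (Matrix.of fun i j : Fin 2 => if i.val + j.val + 1 = 2 then (1 : L) else 0)).Local v × (UnitaryGroup.cmDatum L 1 (Matrix.of fun i j : Fin 1 => if i.val + j.val + 1 = 1 then (1 : L) else 0)).Local v), IsCompact C → ∃ B : ℝ, ∀ s ∈ C, IsLocalGRegular L v s → ‖(𝔇.DH s : ℂ) * 𝔇.packetCharH ρ s‖ ≤ B) := (F0P3cStCharTSHcbH.hHBH_of_compactBound 𝔇 πSt hSq hBnd (IsLocalGRegular L v))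
  have a_hlabels : (∀ ξ' : ((UnitaryGroup.cmDatum L 2 (Matrix.of fun i j : Fin 2 => if i.val + j.val + 1 = 2 then (1 : L) else 0)).Local v × (UnitaryGroup.cmDatum L 1 (Matrix.of fun i j : Fin 1 => if i.val + j.val + 1 = 1 then (1 : L) else 0)).Local v) →* ℂˣ, Continuous ξ' → ∃ (η₁ η₂ : ↥(normOneUnits (conjLocal L (IsCMField.complexConj L) v)) →* ℂˣ), Continuous (fun x => ((η₁ x : ℂˣ) : ℂ)) ∧ Continuous (fun x => ((η₂ x : ℂˣ) : ℂ)) ∧ KeysCaseTwoLabels L v (μ.semilocalComponent L v) η₁ η₂ (𝔇.pi2 ξ') (𝔇.piN ξ')) := (fun ξ' hξ' => by rw [hpi2E, hpiNE]; exact hlab₀ ξ' hξ')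
  have a_hSt : (∀ ψ' : ↥(Subgroup.center (Gqs L v)) →* ℂˣ, Continuous ψ' → ∃ ψ : ↥(normOneUnits (conjLocal L (IsCMField.complexConj L) v)) →* ℂˣ, Continuous ψ ∧ 𝔇.stG ψ' ≠ 𝔇.detG ψ' ∧ ∀ c : IrrClass (Gqs L v), c.IsConstituentOf (UnitaryGroup.cmPrincipalSeries L 3 v (UnitaryGroup.cmTorusCharPair L v (halfModulusChar (UnitaryGroup.LocalRing L v) * halfModulusChar (UnitaryGroup.LocalRing L v))⁻¹ ψ)) ↔ (c = 𝔇.stG ψ' ∨ c = 𝔇.detG ψ')) := (fun ψ' hψ' => by rw [hstGE, hdetGE]; obtain ⟨-, h2, h3, -, -, -, -⟩ := hStψ ψ' hψ'; exact ⟨ψ'.comp ιZ, hψ'.comp hιc, h2, h3⟩)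
  have a_hStJH : (∀ ψ₀ : ↥(normOneUnits (conjLocal L (IsCMField.complexConj L) v)) →* ℂˣ, Continuous (fun x => ((ψ₀ x : ℂˣ) : ℂ)) → ∃ ψ : ↥(Subgroup.center (Gqs L v)) →* ℂˣ, Continuous ψ ∧ ∀ c : IrrClass (Gqs L v), c.IsConstituentOf (UnitaryGroup.cmPrincipalSeries L 3 v (UnitaryGroup.cmTorusCharPair L v (halfModulusChar (UnitaryGroup.LocalRing L v) * halfModulusChar (UnitaryGroup.LocalRing L v))⁻¹ ψ₀)) ↔ (c = 𝔇.stG ψ ∨ c = 𝔇.detG ψ)) := (F0P3cStCharTSStJH.stJH_datum L v hns ιZ hιc hιval stG₀ detG₀ (fun ψ hψ => (hStψ ψ hψ).2.2.1) 𝔇 hstGE hdetGE)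
  have a_hKeysJH : (∀ (η₁ η₂ : ↥(normOneUnits (conjLocal L (IsCMField.complexConj L) v)) →* ℂˣ), Continuous (fun x => ((η₁ x : ℂˣ) : ℂ)) → Continuous (fun x => ((η₂ x : ℂˣ) : ℂ)) → ∃ ξ' : ((UnitaryGroup.cmDatum L 2 (Matrix.of fun i j : Fin 2 => if i.val + j.val + 1 = 2 then (1 : L) else 0)).Local v × (UnitaryGroup.cmDatum L 1 (Matrix.of fun i j : Fin 1 => if i.val + j.val + 1 = 1 then (1 : L) else 0)).Local v) →* ℂˣ, Continuous ξ' ∧ KeysCaseTwoLabels L v (μ.semilocalComponent L v) η₁ η₂ (𝔇.pi2 ξ') (𝔇.piN ξ')) := (fun η₁ η₂ h1 h2 => by rw [hpi2E, hpiNE]; exact hpairs₀ η₁ η₂ h1 h2)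
  have a_hM1lc : (∀ ρ ∈ 𝔇.sqPacketsH, ∀ a : ((UnitaryGroup.cmDatum L 2 (Matrix.of fun i j : Fin 2 => if i.val + j.val + 1 = 2 then (1 : L) else 0)).Local v × (UnitaryGroup.cmDatum L 1 (Matrix.of fun i j : Fin 1 => if i.val + j.val + 1 = 1 then (1 : L) else 0)).Local v), IsLocalGRegular L v a → ∀ᶠ a' in 𝓝 a, 𝔇.packetCharH ρ a' = 𝔇.packetCharH ρ a) := (fun ρ hρ a ha => by rw [hSq, Set.mem_singleton_iff] at hρ; subst hρ; have e : 𝔇.packetCharH {πSt} = Θ := funext fun h => (by simp only [Ch12Sec5.EllipticData.packetCharH, Finset.sum_singleton, hcharHE]); rw [e]; exact hΘlc a ha)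
  have a_hcovA : (∀ γ : Gqs L v, IsRegularElt (γ.val : GL (Fin 3) (UnitaryGroup.LocalRing L v)) → ∃ T' ∈ 𝔇.cartanAll, ∃ x : Gqs L v, ∀ g : Gqs L v, g ∈ Subgroup.centralizer ({γ} : Set (Gqs L v)) ↔ x⁻¹ * g * x ∈ T') := (fun γ hγ => by obtain ⟨T', hT', x, hx⟩ := hcovGO γ hγ; exact ⟨T', (hAllE T').2 (by rw [hcartanGE]; exact Finset.mem_insert.1 hT'), x, hx⟩)
  have a_hncA : (∀ T' ∈ 𝔇.cartanAll, ∀ T'' ∈ 𝔇.cartanAll, T' ≠ T'' → ∀ y : Gqs L v, ¬ ∀ h : Gqs L v, h ∈ T'' ↔ y⁻¹ * h * y ∈ T') := (fun T' hT' T'' hT'' hne => hncGO T' (by have h1 := (hAllE T').1 hT'; rw [hcartanGE] at h1; exact Finset.mem_insert.2 h1) T'' (by have h2 := (hAllE T'').1 hT''; rw [hcartanGE] at h2; exact Finset.mem_insert.2 h2) hne)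
  have a_hcptA : (∀ T' ∈ 𝔇.cartanAll, T' ≠ (cmBorelTriple L 3 v).M → IsCompact (T' : Set (Gqs L v))) := (fun T' hT' hne => by rcases (hAllE T').1 hT' with h | h; exacts [absurd h hne, (hcartO T' (hcartanGE ▸ h)).1])
  have a_hinvT : (∀ T' ∈ 𝔇.cartanAll, (𝔇.μT T').IsInvInvariant) := (fun T' hT' => by rw [hμTE]; rcases (hAllE T').1 hT' with h | h; exacts [h ▸ hinvMO, hinvGO T' (hcartanGE ▸ h)])
  have a_hcoreT : (∀ T' ∈ 𝔇.cartanAll, 𝔇.μT T' (compactCore ↥T') = 1) := (fun T' hT' => by rw [hμTE]; rcases (hAllE T').1 hT' with h | h; exacts [h ▸ hcoreMO, hcoreGO T' (hcartanGE ▸ h)])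
  have a_hIrr : (∀ π ∈ 𝔇.irredPS, ∃ (χ₁ : (UnitaryGroup.LocalRing L v)ˣ →* ℂˣ) (χ₂ : ↥(normOneUnits (conjLocal L (IsCMField.complexConj L) v)) →* ℂˣ), Continuous (fun x => ((χ₁ x : ℂˣ) : ℂ)) ∧ Continuous (fun x => ((χ₂ x : ℂˣ) : ℂ)) ∧ (UnitaryGroup.cmPrincipalSeries L 3 v (UnitaryGroup.cmTorusCharPair L v χ₁ χ₂)).IsIrreducible ∧ π.IsConstituentOf (UnitaryGroup.cmPrincipalSeries L 3 v (UnitaryGroup.cmTorusCharPair L v χ₁ χ₂))) := hirrE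
  have a_hKeys : (∀ ξ' : ((UnitaryGroup.cmDatum L 2 (Matrix.of fun i j : Fin 2 => if i.val + j.val + 1 = 2 then (1 : L) else 0)).Local v × (UnitaryGroup.cmDatum L 1 (Matrix.of fun i j : Fin 1 => if i.val + j.val + 1 = 1 then (1 : L) else 0)).Local v) →* ℂˣ, (𝔇.pi2 ξ').IsSquareIntegrable 𝔇.μGZ ∧ ¬ (𝔇.piN ξ').IsSquareIntegrable 𝔇.μGZ) := (fun ξ' => by rw [hpi2E, hpiNE, hμGZ]; exact hL2₀ ξ')
  have a_hDet : 𝔇.DetNotL2 := hSD.2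
  have a_hM1H : 𝔇.PacketCharHRegularity := hM1H
  have a_hStL2 : (∀ ψ' : ↥(Subgroup.center (Gqs L v)) →* ℂˣ, Continuous ψ' → 𝔇.IsL2 (𝔇.stG ψ')) := hSD.1
  have a_eCartanG : 𝔇.cartanG = Sell := hcartanGE
  have a_eMuT : (∀ T' : Subgroup (Gqs L v), 𝔇.μT T' = μTf T') := hμTE
  have a_eCartanH : 𝔇.cartanH = SH := hcartanHE
  have a_eMuTH : (∀ T' : Subgroup ((UnitaryGroup.cmDatum L 2 (Matrix.of fun i j : Fin 2 => if i.val + j.val + 1 = 2 then (1 : L) else 0)).Local v × (UnitaryGroup.cmDatum L 1 (Matrix.of fun i j : Fin 1 => if i.val + j.val + 1 = 1 then (1 : L) else 0)).Local v), 𝔇.μTH T' = μTHf T') := hμTHE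
  have a_eRegH : (∀ a : ((UnitaryGroup.cmDatum L 2 (Matrix.of fun i j : Fin 2 => if i.val + j.val + 1 = 2 then (1 : L) else 0)).Local v × (UnitaryGroup.cmDatum L 1 (Matrix.of fun i j : Fin 1 => if i.val + j.val + 1 = 1 then (1 : L) else 0)).Local v), a ∈ 𝔇.regH ↔ IsLocalGRegular L v a) := (fun a => by rw [hregHE]; exact Iff.rfl)
  have a_eEllH : (∀ a : ((UnitaryGroup.cmDatum L 2 (Matrix.of fun i j : Fin 2 => if i.val + j.val + 1 = 2 then (1 : L) else 0)).Local v × (UnitaryGroup.cmDatum L 1 (Matrix.of fun i j : Fin 1 => if i.val + j.val + 1 = 1 then (1 : L) else 0)).Local v), a ∈ 𝔇.ellH ↔ IsLocalGRegular L v a ∧ IsCompact ((Subgroup.centralizer ({a} : Set ((UnitaryGroup.cmDatum L 2 (Matrix.of fun i j : Fin 2 => if i.val + j.val + 1 = 2 then (1 : L) else 0)).Local v × (UnitaryGroup.cmDatum L 1 (Matrix.of fun i j : Fin 1 => if i.val + j.val + 1 = 1 then (1 : L) else 0)).Local v)) : Subgroup ((UnitaryGroup.cmDatum L 2 (Matrix.of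 fun i j : Fin 2 => if i.val + j.val + 1 = 2 then (1 : L) else 0)).Local v × (UnitaryGroup.cmDatum L 1 (Matrix.of fun i j : Fin 1 => if i.val + j.val + 1 = 1 then (1 : L) else 0)).Local v)) : Set ((UnitaryGroup.cmDatum L 2 (Matrix.of fun i j : Fin 2 => if i.val + j.val + 1 = 2 then (1 : L) else 0)).Local v × (UnitaryGroup.cmDatum L 1 (Matrix.of fun i j : Fin 1 => if i.val + j.val + 1 = 1 then (1 : L) else 0)).Local v))) := (fun a => by rw [hellHE]; exact Iff.rfl)
  have a_eSq : 𝔇.sqPacketsH = {({πSt} : Finset (IrrClass ((UnitaryGroup.cmDatum L 2 (Matrix.of fun i j : Fin 2 => if i.val + j.val + 1 = 2 then (1 : L) else 0)).Local v × (UnitaryGroup.cmDatum L 1 (Matrix.of fun i j : Fin 1 => if i.val + j.val + 1 = 1 then (1 : L) else 0)).Local v)))} := hSq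
  have a_eIrr : (∀ π : IrrClass (Gqs L v), (∃ (χ₁ : (UnitaryGroup.LocalRing L v)ˣ →* ℂˣ) (χ₂ : ↥(normOneUnits (conjLocal L (IsCMField.complexConj L) v)) →* ℂˣ), Continuous (fun x => ((χ₁ x : ℂˣ) : ℂ)) ∧ Continuous (fun x => ((χ₂ x : ℂˣ) : ℂ)) ∧ (UnitaryGroup.cmPrincipalSeries L 3 v (UnitaryGroup.cmTorusCharPair L v χ₁ χ₂)).IsIrreducible ∧ π.IsConstituentOf (UnitaryGroup.cmPrincipalSeries L 3 v (UnitaryGroup.cmTorusCharPair L v χ₁ χ₂))) → π ∈ 𝔇.irredPS) := hirrE'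
  have a_eLab : (∀ (η₁ η₂ : ↥(normOneUnits (conjLocal L (IsCMField.complexConj L) v)) →* ℂˣ), Continuous (fun x => ((η₁ x : ℂˣ) : ℂ)) → Continuous (fun x => ((η₂ x : ℂˣ) : ℂ)) → ∀ ξ' : ((UnitaryGroup.cmDatum L 2 (Matrix.of fun i j : Fin 2 => if i.val + j.val + 1 = 2 then (1 : L) else 0)).Local v × (UnitaryGroup.cmDatum L 1 (Matrix.of fun i j : Fin 1 => if i.val + j.val + 1 = 1 then (1 : L) else 0)).Local v) →* ℂˣ, (∀ hh : ((UnitaryGroup.cmDatum L 2 (Matrix.of fun i j : Fin 2 => if i.val + j.val + 1 = 2 then (1 : L) else 0)).Local v × (UnitaryGroup.cmDatum L 1 (Matrix.of fun i j : Fin 1 => if i.val + j.val + 1 = 1 then (1 : L) else 0)).Local v), ξ' hh = η₁ (localDet (IsCMField.complexConj L) v (isUnit_antidiagOne_det L 2) hh.1) * η₂ (localDet (IsCMField.complexConj L) v (isUnit_antidiagOne_det L 2) hh.1 * localDet (IsCMField.complexConj L) v (isUnit_antidiagOne_det L 1) hh.2)) → KeysCaseTwoLabels L v (μ.semilocalComponent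 L v) η₁ η₂ (𝔇.pi2 ξ') (𝔇.piN ξ')) := (fun η₁ η₂ h1 h2 ξ' hξ' => by rw [hpi2E, hpiNE]; exact hlabF₀ η₁ η₂ h1 h2 ξ' hξ')
  have a_eCharH : (∀ ρ : IrrClass ((UnitaryGroup.cmDatum L 2 (Matrix.of fun i j : Fin 2 => if i.val + j.val + 1 = 2 then (1 : L) else 0)).Local v × (UnitaryGroup.cmDatum L 1 (Matrix.of fun i j : Fin 1 => if i.val + j.val + 1 = 1 then (1 : L) else 0)).Local v), 𝔇.charH ρ = 𝔇.charH πSt) := (fun ρ => by rw [hcharHE])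
  have a_eSt : (∃ (ιZ : ↥(normOneUnits (conjLocal L (IsCMField.complexConj L) v)) →* ↥(Subgroup.center (Gqs L v))) (detZ : (Gqs L v) →* ↥(Subgroup.center (Gqs L v))), Continuous ιZ ∧ Continuous detZ ∧ (∀ z : ↥(normOneUnits (conjLocal L (IsCMField.complexConj L) v)), ((ιZ z).val.val.val : Matrix (Fin 3) (Fin 3) (UnitaryGroup.LocalRing L v)) = (((z : (UnitaryGroup.LocalRing L v)ˣ) : UnitaryGroup.LocalRing L v)) • (1 : Matrix (Fin 3) (Fin 3) (UnitaryGroup.LocalRing L v))) ∧ (∀ g : (Gqs L v), ((detZ g).val.val.val : Matrix (Fin 3) (Fin 3) (UnitaryGroup.LocalRing L v)) = (g.val.val : Matrix (Fin 3) (Fin 3) (UnitaryGroup.LocalRing L v)).det • (1 : Matrix (Fin 3) (Fin 3) (UnitaryGroup.LocalRing L v))) ∧ ∀ ψ : ↥(Subgroup.center (Gqs L v)) →* ℂˣ, Continuous ψ → (∃ hopen : IsOpen (((ψ.comp detZ).ker : Subgroup (Gqs L v)) : Set (Gqs L v)), 𝔇.detG ψ = IrrClass.mk (SmoothIrrep.ofChar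 (ψ.comp detZ) hopen)) ∧ 𝔇.stG ψ ≠ 𝔇.detG ψ ∧ (∀ c : IrrClass (Gqs L v), c.IsConstituentOf (cmPrincipalSeries L 3 v (cmTorusCharPair L v (halfModulusChar (UnitaryGroup.LocalRing L v) * halfModulusChar (UnitaryGroup.LocalRing L v))⁻¹ (ψ.comp ιZ))) ↔ (c = 𝔇.stG ψ ∨ c = 𝔇.detG ψ)) ∧ (𝔇.stG ψ).IsSquareIntegrable μZ ∧ ¬ (𝔇.detG ψ).IsSquareIntegrable μZ) := ⟨ιZ, detZ, hιc, hdetZc, hιval, hdetZval, fun ψ hψ => by rw [hstGE, hdetGE]; obtain ⟨h1, h2, h3, h4, h5, -, -⟩ := hStψ ψ hψ; exact ⟨h1, h2, h3, h4, h5⟩⟩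
  obtain ⟨hUpTr, h1252, hPCE, h61a, h61b, h61c, hEllNotPS, hM5, hR0, d, hPL, hdpos⟩ := hBlock 𝔇 par a_hC01 a_hC02 a_hC03 a_hC04 a_hC05 a_hC06 a_hC07 a_hE a_hchar a_hAll a_hHaar a_hcart a_hHaarG a_hfinG a_hker a_eDG a_eDH a_hKH a_hFH a_hHBH a_hNL a_hPSpar a_hLdsF a_hW a_hStH a_hRegH a_hUp a_hHBHP a_hlabels a_hSt a_hStJH a_hKeysJH a_hM1lc a_hcovA a_hncA a_hcptA a_hinvT a_hcoreT a_hIrr a_hKeys a_hDet a_hM1H a_hStL2 a_eCartanG a_eMuT a_eCartanH a_eMuTH a_eRegH a_eEllH a_eSq a_eIrr a_eLab a_eCharH a_eSt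
  exact hneg ⟨𝔇, d, T, par, (μ.semilocalComponent L v), a_hC01, a_hC02, a_hC03, a_hC04, a_hC05, a_hC06, a_hC07, a_hE, a_hchar, a_hAll, a_hHaar, a_hcart, a_hHaarG, a_hfinG, a_hker, a_eDG, a_eDH, a_hKH, a_hFH, a_hHBH, a_hNL, a_hPSpar, a_hLdsF, a_hW, (isQuadraticCharExtension_semilocalComponent_of_baseChange_eq μ hμω v), (Units.continuous_val.comp (UnitaryGroup.continuous_semilocalComponent L μ)), a_hStH, a_hRegH, a_hUp, a_hHBHP, ((shalikaGermResidueAtTorus_iff L (qsForm L) v mQv T).1 hGerm), a_hlabels, a_hSt, a_hStJH, a_hKeysJH, a_hM1lc, a_hcovA, a_hncA, a_hcptA, a_hinvT, a_hcoreT, a_hIrr, a_hKeys, hT3, a_hDet, hKeysRed, (F0P3cStCharTSLdsTwoOfTwo.ldsTwo_of_ldsReducibleTwo L v hns hLdsRedTwo), (by rw [show (fun x : Gqs L v => (𝔇.DG x)⁻¹) = (fun g : (Gqs L v) => (((NNReal.sqrt (NNReal.sqrt ((∏ w : PlacesOver L v, IsNonarchimedeanLocalField.normAbs (w.1.adicCompletion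 L) (((g.val : GL (Fin 3) (UnitaryGroup.LocalRing L v)).val.charpoly.discr) w)) * ((∏ w : PlacesOver L v, IsNonarchimedeanLocalField.normAbs (w.1.adicCompletion L) (((g.val : GL (Fin 3) (UnitaryGroup.LocalRing L v)).val.det) w)) ^ 2)⁻¹)) : ℝ≥0) : ℝ))⁻¹) from funext fun g => by rw [hDGf], hμG]; exact hDGliO), hUpTr, h1252, hPCE, h61a, h61b, h61c, hEllNotPS, a_hM1H, hM5, hR0, a_hStL2, hPL, hdpos, hHCB⟩

end Summit.HodgeConjecture.HodgeConjecture.Cruxes.H413.F0P3cStCharTSRung0Six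

end
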